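import Literature.NumberTheory.GaloisRepresentations.DifferentSubfieldJump
import Literature.NumberTheory.GaloisRepresentations.ArtinRepresentationProofs
import Literature.NumberTheory.GaloisRepresentations.ArtinConductorHerbrandProofs
import Mathlib.NumberTheory.RamificationInertia.Basic
import HarnessLib

/-!
# The Artin conductor of an induced character: the local induction formula
(Neukirch VII (11.7) (iii) at a prime; Serre, *Local Fields*, Ch. VI §2 Prop. 4, Ch. IV §1 Cor.
to Prop. 4), proofs only

Topic `NumberTheory/GaloisRepresentations`; namespace `Literature.NumberTheory.GaloisRepresentations`.
This file serves the named fact `Literature.NumberTheory.Automorphic.brauer_completedArtinLFunction_eq_prod_zpow`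
(Brauer's factorisation of the completed Artin `L`-function, Neukirch VII, proof of (12.6)), whose
residual hypothesis after `Automorphic/ArtinLFunctionsBrauerCompletedReduction` is Neukirch VII
(11.7) (iii) — the conductor of a character induced from a subgroup,
`𝔣(L|K, χ_*) = 𝔡_{K'|K}^{χ(1)} N_{K'|K}(𝔣(L|K', χ))` — and provides its **local core** in the
tree's Dedekind/Galois setting `(R, K, L)`, `S = integralClosure R L`, `G = Gal(L/K)`,
`F` an intermediate field with `H = Gal(L/F)`, `S_F = integralClosure R F`, together with the
transport lemmas used to feed the conductors of `Γ_K` and `Γ_M` (two different algebraic closures)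
into one finite Galois extension.  Everything is **proved**; no definition, no named fact.

Instead of Neukirch's double-coset computation we use the class-function form of the Artin
character (Neukirch VII §11, p. 533: "the central function `a_𝔭 = Σ_{𝔓 ∣ 𝔭} a_𝔓` … is the
character of a representation … `f(χ, 𝔭) = (χ, a_𝔭)`"), in numerator form (Serre VI §2, `f(χ)
= Σᵢ (gᵢ/g₀)(χ(1) - χ(Gᵢ))`, the tree's `artinSum`/`lowerIndex`):

* `ramificationSubgroup_eq_comap_of_equivariant`, `lowerIndex_eq_of_equivariant`,
  `card_ramificationSubgroup_eq_of_equivariant` (+ comap forms) — transport of the lower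
  numbering filtration along a ring isomorphism equivariant for a group homomorphism;
* `GaloisRep.artinConductorAt_eq_finsum_of_algHom`,
  `GaloisRep.card_mul_artinConductorAt_eq_natCast_sum_of_algHom` — the tree's lower-numbering
  formula for `a_𝔓(ρ)` (`GaloisRep.artinConductorAt_eq_finsum_ramificationSubgroup_holds`)
  through an *abstract* finite normal `E₀/F` with an `F`-embedding `φ : E₀ → F̄` and a compatible
  `r₀ : Γ_F → Gal(E₀/F)`, and its form `#G₀ a_𝔓(ρ) = Σ_{i<N} #Gᵢ codim M^{Gᵢ}` for `ρ = τ ∘ r₀`;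
* `lowerIndex_smul_conj`, `localArtin_smul_conj`, `sum_localArtin_mul`, `artinClassFun_conj`,
  `card_inertia_mul_sum_artinClassFun_mul` — with `a_𝔓(1) = Σ_t i_𝔓(t)`, `a_𝔓(s) = -i_𝔓(s)`
  (`s ≠ 1`) and `A_𝔭 = Σ_{𝔓 ∣ 𝔭} f(𝔓|𝔭) a_𝔓`: `A_𝔭` is a class function and
  `#I_𝔓 Σ_s A_𝔭(s) χ(s) = #G Σ_s i_𝔓(s)(χ(1) - χ(s))` for a class function `χ` (`f(χ, 𝔭) = (χ, a_𝔭)`);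
* `artinClassFun_eq_sum_sub` — restriction of `A_𝔭` to a subgroup along a tower `T ⊆ B ⊆ S`:
  `A^Γ_𝔭(h) = Σ_{𝔮 ∣ 𝔭} f(𝔮|𝔭)(A^Δ_𝔮(h) + [h = 1] Σ_{𝔓 ∣ 𝔮} f(𝔓|𝔮) Σ_{t ∉ Δ} i_𝔓(t))` (Serre VI §2 Prop. 4,
  `a_G|_H = λ r_H + f a_H`, in global numerator form);
* `emultiplicity_differentIdeal_eq_zero_of_ramificationIdx_eq_one` (unramified primes do not
  divide the different) and
  `card_inertia_mul_emultiplicity_differentIdeal_under_eq_sum_lowerIndex` —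
  **`e(𝔓|𝔓_F) v_{𝔓_F}(𝔇_{S_F/R}) = Σ_{s ∉ H} i_G(s)`** at every prime (Serre IV §1 Cor. to Prop. 4,
  via the tree's `emultiplicity_differentIdeal_eq_finsum_add_card_mul` for the decomposition
  fields `L^{D}`, `L^{H ∩ D}` and transitivity of the different), and its weighted sum
  `sum_inertiaDeg_mul_sum_lowerIndex_not_mem`: `Σ_{𝔓 ∣ 𝔮} f(𝔓|𝔮) Σ_{t ∉ H} i_𝔓(t) = #H v_𝔮(𝔇_{S_F/R})`;
* `sum_mul_eq_index_mul_sum_of_eq_sum_quotient` — Frobenius reciprocity for the coset form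
  `χ(s) = Σ_{q ∈ G/H} θ̇(q̇⁻¹ s q̇)` of an induced function (Serre, *Linear Representations*, §7.2);
* `card_inertia_inv_mul_sum_lowerIndex_eq_sum_of_induced` — **the local induction formula**:
  `(1/#I_{𝔓₀}) Σ_s i_{𝔓₀}(s)(χ(1) - χ(s)) = Σ_{𝔮 ∣ 𝔭} f(𝔮|𝔭) (θ(1) v_𝔮(𝔇_{S_F/R}) + (1/#I^H_{P(𝔮)}) Σ_{t ∈ H} i_{P(𝔮)}(t)(θ(1) - θ(t)))`,
  i.e. Neukirch's `f(χ_*|G_𝔓) = Σ_τ (ν_{𝔓'_τ} χ(1) + f_{𝔓'_τ} f(χ|H_{𝔓^τ}))` (VII (11.7) (iii), proof).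

The characteristic-`0` hypotheses (`[CharZero R] [CharZero L]`, finite residue fields) are those of
the application `R = 𝓞 K`; they make the separability of all fraction-field and residue-field
extensions automatic.

## Mathlib / tree search

Mathlib: `Ideal.ramificationSubgroup`-free; `Ideal.inertiaDeg`, `Ideal.ramificationIdx` (new API,
`inertiaDeg_tower`, `ramificationIdx_tower`, `inertiaDeg_smul`, `ramificationIdx_eq_one_iff`),
`not_dvd_differentIdeal_iff`, `Ideal.sum_ramification_inertia`, `IsDedekindDomain.primesOverFinset`,
`Algebra.IsInvariant.exists_smul_of_under_eq`, `IsGalois.card_fixingSubgroup_eq_finrank`,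
`AlgHom.equivFieldRange`, `AlgEquiv.autCongr`, `AlgEquiv.mapIntegralClosure`.  Tree:
`lowerIndex`, `lowerIndex_subgroup`, `Ideal.ramificationSubgroup`,
`GaloisRep.artinConductorAt_eq_finsum_ramificationSubgroup_holds`, `Representation.codimFixed`,
`codimFixed_bot`, `ramificationIdx'_under_eq_card_inertia`,
`ncard_primesOver_mul_card_inertia_mul_inertiaDeg_of_isSeparable`,
`card_inertia_eq_ramificationIdxIn_of_isSeparable`, `isGaloisGroup_fixingSubgroup_integralClosure`,
`emultiplicity_differentIdeal_eq_finsum_add_card_mul`, `emultiplicity_differentIdeal_eq_add`,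
`isSeparable_residue_of_finite`.  `lean search` for `11.7`, `artinConductor.*induc`,
`conductor.*relNorm`: nothing beyond the reduction files.  Nothing here duplicates an existing
declaration.

## References

* J. Neukirch, *Algebraic Number Theory*, Grundlehren 322 (1999), VII §11: (11.7) (iii) and its
  proof (pp. 533–534), the central function `a_𝔭` (p. 533). [NeukirchANT1999]
* J.-P. Serre, *Local Fields*, GTM 67 (1979), Ch. IV §1 Prop. 2, Prop. 4 and Corollary; Ch. VI §2
  (`a_G`, Prop. 1, Prop. 2 with Cor. 1–1', Prop. 3 Cor., Prop. 4 and Corollary). [SerreLocalFields1979]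
* J.-P. Serre, *Linear Representations of Finite Groups*, GTM 42 (1977), §7.2 Thm. 13.
  [SerreLinearRepresentations1977]
-/

open scoped Pointwise NumberField

noncomputable section

open Finset IsDedekindDomain Field Module NumberField

namespace Literature.NumberTheory.GaloisRepresentations

universe u v w


/-! ### Transport of the ramification filtration along an equivariant ring isomorphism -/

section Transport

variable {S S' : Type*} [CommRing S] [CommRing S'] {G G' : Type*} [Group G] [Group G']
  [MulSemiringAction G S] [MulSemiringAction G' S']

/-- Membership in the image of an ideal under a ring isomorphism. [folklore] -/
theorem mem_map_ringEquiv_iff (e : S' ≃+* S) (I : Ideal S') (y : S) :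
    y ∈ I.map (e : S' →+* S) ↔ e.symm y ∈ I := by
  rw [Ideal.map_comap_of_equiv, Ideal.mem_comap]

/-- **Transport of the lower-numbering filtration.**  Let `φ : G' →* G` be a group homomorphism
and `e : S' ≃+* S` a ring isomorphism with `e (g • x) = φ g • e x`.  Then for every ideal `𝔓'`
of `S'`, the ramification groups of `𝔓'` under `G'` are the preimages under `φ` of the
ramification groups of `e(𝔓')` under `G` (both are defined by `σ • 𝔓 = 𝔓` and
`σ • x ≡ x mod 𝔓^(i+1)`).
Ref: Serre, *Local Fields*, Ch. IV §1 (functoriality of the definition). [folklore] -/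
theorem ramificationSubgroup_eq_comap_of_equivariant (φ : G' →* G) (e : S' ≃+* S)
    (he : ∀ (g : G') (x : S'), e (g • x) = φ g • e x) (𝔓' : Ideal S') (i : ℕ) :
    𝔓'.ramificationSubgroup G' i = ((𝔓'.map (e : S' →+* S)).ramificationSubgroup G i).comap φ := by
  ext σ
  rw [Subgroup.mem_comap, Ideal.mem_ramificationSubgroup_iff, Ideal.mem_ramificationSubgroup_iff]
  have hinv : ∀ (x : S'), e (σ⁻¹ • x) = (φ σ)⁻¹ • e x := fun x => by rw [← map_inv, he]
  refine and_congr ?_ ?_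
  · -- stabiliser condition
    constructor
    · intro h
      ext y
      rw [Ideal.mem_pointwise_smul_iff_inv_smul_mem, mem_map_ringEquiv_iff, mem_map_ringEquiv_iff]
      have hy : (φ σ)⁻¹ • y = e (σ⁻¹ • e.symm y) := by rw [hinv, RingEquiv.apply_symm_apply]
      rw [hy, RingEquiv.symm_apply_apply, ← Ideal.mem_pointwise_smul_iff_inv_smul_mem, h]
    · intro h
      ext x
      rw [Ideal.mem_pointwise_smul_iff_inv_smul_mem]
      have h1 : e x ∈ (φ σ) • 𝔓'.map (e : S' →+* S) ↔ e x ∈ 𝔓'.map (e : S' →+* S) := by rw [h]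
      rw [Ideal.mem_pointwise_smul_iff_inv_smul_mem, ← hinv, mem_map_ringEquiv_iff,
        mem_map_ringEquiv_iff, RingEquiv.symm_apply_apply, RingEquiv.symm_apply_apply] at h1
      exact h1
  · -- congruence condition
    rw [← Ideal.map_pow]
    constructor
    · intro h y
      have hy : φ σ • y - y = e (σ • e.symm y - e.symm y) := by
        rw [map_sub, he, RingEquiv.apply_symm_apply]
      rw [hy, mem_map_ringEquiv_iff, RingEquiv.symm_apply_apply]
      exact h _
    · intro h x
      have hx := h (e x)
      rw [← he, ← map_sub, mem_map_ringEquiv_iff, RingEquiv.symm_apply_apply] at hx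
      exact hx

/-- Transport of Serre's function `i_G` along an equivariant ring isomorphism
(`ramificationSubgroup_eq_comap_of_equivariant`).
Ref: Serre, *Local Fields*, Ch. IV §1. [folklore] -/
theorem lowerIndex_eq_of_equivariant (φ : G' →* G) (e : S' ≃+* S)
    (he : ∀ (g : G') (x : S'), e (g • x) = φ g • e x) (𝔓' : Ideal S') (s : G') :
    lowerIndex 𝔓' G' s = lowerIndex (𝔓'.map (e : S' →+* S)) G (φ s) := by
  simp only [lowerIndex, ramificationSubgroup_eq_comap_of_equivariant φ e he 𝔓', Subgroup.mem_comap]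

/-- If moreover `φ` is injective, `#G'_i = #(G_i ⊓ φ(G'))`. [folklore] -/
theorem card_ramificationSubgroup_eq_of_equivariant (φ : G' →* G) (hφ : Function.Injective φ)
    (e : S' ≃+* S) (he : ∀ (g : G') (x : S'), e (g • x) = φ g • e x) (𝔓' : Ideal S') (i : ℕ) :
    Nat.card (𝔓'.ramificationSubgroup G' i) =
      Nat.card ↥((𝔓'.map (e : S' →+* S)).ramificationSubgroup G i ⊓ φ.range) := by
  rw [ramificationSubgroup_eq_comap_of_equivariant φ e he 𝔓' i,
    Nat.card_congr (Subgroup.equivMapOfInjective _ φ hφ).toEquiv, Subgroup.map_comap_eq, inf_comm]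

/-- If `φ` is an isomorphism, `#G'_i = #G_i`. [folklore] -/
theorem card_ramificationSubgroup_eq_of_equivariant_of_surjective (φ : G' →* G)
    (hφ : Function.Injective φ) (hφ' : Function.Surjective φ)
    (e : S' ≃+* S) (he : ∀ (g : G') (x : S'), e (g • x) = φ g • e x) (𝔓' : Ideal S') (i : ℕ) :
    Nat.card (𝔓'.ramificationSubgroup G' i) =
      Nat.card ((𝔓'.map (e : S' →+* S)).ramificationSubgroup G i) := by
  rw [card_ramificationSubgroup_eq_of_equivariant φ hφ e he, MonoidHom.range_eq_top.mpr hφ',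
    inf_top_eq]


/-- Comap form of `ramificationSubgroup_eq_comap_of_equivariant`: for an ideal `𝔓` of `S`,
the ramification groups of `e⁻¹(𝔓)` under `G'` are the preimages of those of `𝔓`. [folklore] -/
theorem ramificationSubgroup_comap_eq_comap_of_equivariant (φ : G' →* G) (e : S' ≃+* S)
    (he : ∀ (g : G') (x : S'), e (g • x) = φ g • e x) (𝔓 : Ideal S) (i : ℕ) :
    (𝔓.comap (e : S' →+* S)).ramificationSubgroup G' i = (𝔓.ramificationSubgroup G i).comap φ := by
  rw [ramificationSubgroup_eq_comap_of_equivariant φ e he,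
    Ideal.map_comap_of_surjective (e : S' →+* S) e.surjective]

/-- Comap form of `lowerIndex_eq_of_equivariant`. [folklore] -/
theorem lowerIndex_comap_eq_of_equivariant (φ : G' →* G) (e : S' ≃+* S)
    (he : ∀ (g : G') (x : S'), e (g • x) = φ g • e x) (𝔓 : Ideal S) (s : G') :
    lowerIndex (𝔓.comap (e : S' →+* S)) G' s = lowerIndex 𝔓 G (φ s) := by
  rw [lowerIndex_eq_of_equivariant φ e he, Ideal.map_comap_of_surjective (e : S' →+* S) e.surjective]

/-- Comap form of `card_ramificationSubgroup_eq_of_equivariant`. [folklore] -/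
theorem card_ramificationSubgroup_comap_eq_of_equivariant (φ : G' →* G)
    (hφ : Function.Injective φ) (e : S' ≃+* S)
    (he : ∀ (g : G') (x : S'), e (g • x) = φ g • e x) (𝔓 : Ideal S) (i : ℕ) :
    Nat.card ((𝔓.comap (e : S' →+* S)).ramificationSubgroup G' i) =
      Nat.card ↥(𝔓.ramificationSubgroup G i ⊓ φ.range) := by
  rw [card_ramificationSubgroup_eq_of_equivariant φ hφ e he,
    Ideal.map_comap_of_surjective (e : S' →+* S) e.surjective]

end Transport

/-! ### The lower-numbering formula through an abstract finite normal extension -/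

section AbstractFiniteLevel

variable {F : Type u} [Field F] [NumberField F] {A : Type v} [Field A] [TopologicalSpace A]
  {M : Type w} [AddCommGroup M] [Module A M] [TopologicalSpace M] [FiniteDimensional A M]
  {E₀ : Type*} [Field E₀] [Algebra F E₀] [FiniteDimensional F E₀] [Normal F E₀]

omit [NumberField F] [FiniteDimensional F E₀] [Normal F E₀] in
/-- The integral map `S_{E₀} → \bar ℤ_F` induced by an `F`-embedding `φ : E₀ → F̄` factors through
the ring isomorphism `S_{E₀} ≅ S_{φ(E₀)}` induced by `φ` (Mathlib `AlgHom.equivFieldRange`,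
`AlgEquiv.mapIntegralClosure`) followed by the inclusion `S_{φ(E₀)} → \bar ℤ_F`. [folklore] -/
theorem mapIntegralClosure_eq_comp_equivFieldRange (φ : E₀ →ₐ[F] AlgebraicClosure F)
    (x : integralClosure (𝓞 F) E₀) :
    (φ.restrictScalars (𝓞 F)).mapIntegralClosure x =
      φ.fieldRange.integralClosureToAbsIntegers (𝓞 F)
        ((φ.equivFieldRange.restrictScalars (𝓞 F)).mapIntegralClosure x) := by
  refine Subtype.ext ?_
  rw [AlgHom.coe_mapIntegralClosure, IntermediateField.coe_integralClosureInclusion,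
    AlgEquiv.coe_mapIntegralClosure]
  simp only [AlgHom.coe_restrictScalars', AlgEquiv.coe_restrictScalars,
    AlgHom.equivFieldRange_apply_coe]

/-- **The lower-numbering formula through an abstract finite normal extension** (Serre,
*Local Fields*, Ch. VI §2, Cor. 1' to Prop. 2, combined with inflation, Prop. 3 Cor.): the tree's
`GaloisRep.artinConductorAt_eq_finsum_ramificationSubgroup_holds` computes `a_𝔓(ρ)` for a
representation `ρ` of `Γ_F` factoring through `Gal(E/F)`, `E` a finite normal subextension of
`F̄`, as `Σᵢ (#Gᵢ/#G₀) codim M^{Gᵢ}` with `Gᵢ` the ramification groups of `𝔓 ∩ E` in `Gal(E/F)`.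
Here the same formula is derived for an **abstract** finite normal extension `E₀/F` given with
an `F`-embedding `φ : E₀ → F̄` and a homomorphism `r₀ : Γ_F → Gal(E₀/F)` compatible with `φ`
(`φ (r₀ γ x) = γ • φ x`), through which `ρ` factors (`ρ` trivial on `ker r₀`): with `S₀` the
integral closure of `𝓞 F` in `E₀`, `P₀ = φ⁻¹(𝔓) ∩ S₀` and `Gᵢ = (P₀).ramificationSubgroup Gal(E₀/F) i`,
`a_𝔓(ρ) = Σᵢ (#Gᵢ/#G₀) codim M^{r₀⁻¹ Gᵢ}`.  (Transport of structure along
`E₀ ≅ φ(E₀) ⊆ F̄`; used to compute conductors of representations of `Γ_K` and of `Γ_M`, `M ⊇ K`,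
inside one and the same finite Galois extension.)
[cite: SerreLocalFields1979, Ch. VI §2, Cor. 1' to Prop. 2 and Cor. to Prop. 3] -/
theorem GaloisRep.artinConductorAt_eq_finsum_of_algHom (φ : E₀ →ₐ[F] AlgebraicClosure F)
    (r₀ : absoluteGaloisGroup F →* (E₀ ≃ₐ[F] E₀))
    (hr₀ : ∀ (γ : absoluteGaloisGroup F) (x : E₀), φ (r₀ γ x) = γ • φ x)
    {v : HeightOneSpectrum (𝓞 F)} {𝔓 : Ideal (absIntegers (𝓞 F) F)} (h𝔓 : 𝔓 ∈ v.primesAbove)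
    (ρ : GaloisRep F A M) (hρ : ∀ γ : absoluteGaloisGroup F, r₀ γ = 1 → ρ γ = 1) :
    ρ.artinConductorAt (𝓞 F) 𝔓 =
      ∑ᶠ i : ℕ, ((Nat.card ((𝔓.comap ((φ.restrictScalars (𝓞 F)).mapIntegralClosure.toRingHom :
            integralClosure (𝓞 F) E₀ →+* absIntegers (𝓞 F) F)).ramificationSubgroup
              (E₀ ≃ₐ[F] E₀) i) : ℝ) /
          Nat.card ((𝔓.comap ((φ.restrictScalars (𝓞 F)).mapIntegralClosure.toRingHom :
            integralClosure (𝓞 F) E₀ →+* absIntegers (𝓞 F) F)).ramificationSubgroup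
              (E₀ ≃ₐ[F] E₀) 0)) *
        ρ.codimFixed (((𝔓.comap ((φ.restrictScalars (𝓞 F)).mapIntegralClosure.toRingHom :
            integralClosure (𝓞 F) E₀ →+* absIntegers (𝓞 F) F)).ramificationSubgroup
              (E₀ ≃ₐ[F] E₀) i).comap r₀) := by
  -- the copy `E = φ(E₀) ⊆ F̄` and the transport data
  set φi : integralClosure (𝓞 F) E₀ →+* absIntegers (𝓞 F) F :=
    (φ.restrictScalars (𝓞 F)).mapIntegralClosure.toRingHom with hφi
  set E : IntermediateField F (AlgebraicClosure F) := φ.fieldRange with hEdef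
  set ψ : E₀ ≃ₐ[F] E := φ.equivFieldRange with hψ
  haveI : Normal F E := Normal.of_algEquiv ψ
  haveI : FiniteDimensional F E := LinearEquiv.finiteDimensional ψ.toLinearEquiv
  set e : integralClosure (𝓞 F) E₀ ≃+* integralClosure (𝓞 F) E :=
    ((ψ.restrictScalars (𝓞 F)).mapIntegralClosure).toRingEquiv with he
  set Φ : (E₀ ≃ₐ[F] E₀) ≃* (E ≃ₐ[F] E) := ψ.autCongr with hΦ
  set PE : Ideal (integralClosure (𝓞 F) E) :=
    𝔓.comap (E.integralClosureToAbsIntegers (𝓞 F)) with hPE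
  have hψx : ∀ x : E₀, ((ψ x : E) : AlgebraicClosure F) = φ x := fun x =>
    AlgHom.equivFieldRange_apply_coe φ x
  have hex : ∀ x : integralClosure (𝓞 F) E₀,
      (((e x : integralClosure (𝓞 F) E) : E) : AlgebraicClosure F) = φ (x : E₀) := fun x => hψx x
  -- equivariance of `e`
  have hequiv : ∀ (g : E₀ ≃ₐ[F] E₀) (x : integralClosure (𝓞 F) E₀),
      e (g • x) = Φ.toMonoidHom g • e x := by
    intro g x
    refine Subtype.ext (Subtype.ext ?_)
    change ((ψ ((g • x : integralClosure (𝓞 F) E₀) : E₀) : E) : AlgebraicClosure F) =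
      (((ψ.autCongr g) (ψ (x : E₀)) : E) : AlgebraicClosure F)
    rw [AlgEquiv.autCongr_apply, AlgEquiv.trans_apply, AlgEquiv.trans_apply,
      AlgEquiv.symm_apply_apply, integralClosure.coe_smul, AlgEquiv.smul_def]
  -- `P₀ = e⁻¹(𝔓 ∩ E)`
  have hcomp : 𝔓.comap φi = PE.comap (e : integralClosure (𝓞 F) E₀ →+* integralClosure (𝓞 F) E) := by
    refine Ideal.ext fun x => ?_
    simp only [hPE, Ideal.mem_comap]
    have hx : φi x = E.integralClosureToAbsIntegers (𝓞 F) (e x) :=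
      mapIntegralClosure_eq_comp_equivFieldRange φ x
    rw [hx]
    rfl
  -- `Φ ∘ r₀` is the restriction `Γ_F → Gal(E/F)`
  have hres : Φ.toMonoidHom.comp r₀ = absRestrictNormalHom E := by
    refine MonoidHom.ext fun γ => AlgEquiv.ext fun y => ?_
    obtain ⟨x, rfl⟩ := ψ.surjective y
    apply Subtype.ext
    have h1 : (((Φ.toMonoidHom.comp r₀) γ (ψ x) : E) : AlgebraicClosure F) = φ (r₀ γ x) := by
      change (((ψ.autCongr (r₀ γ)) (ψ x) : E) : AlgebraicClosure F) = _
      rw [AlgEquiv.autCongr_apply, AlgEquiv.trans_apply, AlgEquiv.trans_apply,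
        AlgEquiv.symm_apply_apply, hψx]
    have h2 : ((absRestrictNormalHom E γ (ψ x) : E) : AlgebraicClosure F) = γ • φ x := by
      change ((AlgEquiv.restrictNormalHom E (absoluteGaloisGroup.toAlgEquiv F γ) (ψ x) : E) :
        AlgebraicClosure F) = _
      rw [AlgEquiv.restrictNormalHom_apply, hψx, absoluteGaloisGroup.smul_def]
    rw [h1, h2, hr₀]
  -- `ρ` factors through `Gal(E/F)`
  have hE : ∀ σ : absoluteGaloisGroup F, absRestrictNormalHom E σ = 1 → ρ σ = 1 := by
    intro σ hσ
    refine hρ σ (Φ.injective ?_)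
    rw [map_one, ← MulEquiv.coe_toMonoidHom, ← MonoidHom.comp_apply, hres, hσ]
  rw [GaloisRep.artinConductorAt_eq_finsum_ramificationSubgroup_holds h𝔓 E ρ hE]
  -- transport term by term
  have hG : ∀ i, (𝔓.comap φi).ramificationSubgroup (E₀ ≃ₐ[F] E₀) i =
      (PE.ramificationSubgroup (E ≃ₐ[F] E) i).comap Φ.toMonoidHom := fun i => by
    rw [hcomp, ramificationSubgroup_comap_eq_comap_of_equivariant Φ.toMonoidHom e hequiv PE i]
  have hcard : ∀ i, Nat.card ((𝔓.comap φi).ramificationSubgroup (E₀ ≃ₐ[F] E₀) i) =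
      Nat.card (PE.ramificationSubgroup (E ≃ₐ[F] E) i) := fun i => by
    rw [hcomp, card_ramificationSubgroup_comap_eq_of_equivariant Φ.toMonoidHom Φ.injective e hequiv
      PE i, MonoidHom.range_eq_top.mpr Φ.surjective, inf_top_eq]
  refine finsum_congr fun i => ?_
  show ((Nat.card (PE.ramificationSubgroup (E ≃ₐ[F] E) i) : ℝ) /
        Nat.card (PE.ramificationSubgroup (E ≃ₐ[F] E) 0)) *
      (ρ.codimFixed ((PE.ramificationSubgroup (E ≃ₐ[F] E) i).comap (absRestrictNormalHom E)) : ℝ) =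
    ((Nat.card ((𝔓.comap φi).ramificationSubgroup (E₀ ≃ₐ[F] E₀) i) : ℝ) /
        Nat.card ((𝔓.comap φi).ramificationSubgroup (E₀ ≃ₐ[F] E₀) 0)) *
      (ρ.codimFixed (((𝔓.comap φi).ramificationSubgroup (E₀ ≃ₐ[F] E₀) i).comap r₀) : ℝ)
  rw [hcard i, hcard 0, hG i, Subgroup.comap_comap, hres]

/-! ### Factoring through the finite level: the formula as a finite sum of natural numbers -/

omit [NumberField F] [FiniteDimensional A M] [FiniteDimensional F E₀] [Normal F E₀] in
/-- **Fixed spaces of an inflated representation**: if `ρ = τ ∘ r` with `r : Γ → G` surjective, then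
`M^{r⁻¹ P}` (for `ρ`) is `M^P` (for `τ`), so the codimensions agree.
Ref: Serre, *Local Fields*, Ch. VI §2, Corollary to Prop. 3 (inflation). [folklore] -/
theorem ContinuousRep.codimFixed_comap_eq_of_surjective {Γ G : Type*} [Group Γ] [TopologicalSpace Γ]
    [Group G] (ρ : ContinuousRep Γ A M) (r : Γ →* G) (hr : Function.Surjective r)
    (τ : Representation A G M) (hτ : ∀ γ, (ρ γ : M →ₗ[A] M) = τ (r γ)) (P : Subgroup G) :
    ρ.codimFixed (P.comap r) = Representation.codimFixed τ P := by
  have h : ρ.fixedSubmodule (P.comap r) = Representation.fixedSubmodule τ P := by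
    ext v
    rw [ContinuousRep.mem_fixedSubmodule, Representation.mem_fixedSubmodule]
    refine ⟨fun hv g hg => ?_, fun hv γ hγ => ?_⟩
    · obtain ⟨γ, rfl⟩ := hr g
      rw [← hτ γ]
      exact hv γ (Subgroup.mem_comap.mpr hg)
    · rw [hτ γ]
      exact hv _ (Subgroup.mem_comap.mp hγ)
  rw [ContinuousRep.codimFixed, Representation.codimFixed, h]

omit [NumberField F] [FiniteDimensional A M] [FiniteDimensional F E₀] [Normal F E₀] in
/-- **A representation trivial on the kernel of a surjection factors through it**: if
`r : Γ → G` is surjective and `ρ` is trivial on `ker r`, then `ρ = τ ∘ r` for a representation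
`τ` of `G` (the tree's `Representation.exists_factors_of_ker_le` with `I = ⊤`).
Ref: Serre, *Local Fields*, Ch. VI §2, Prop. 3 (passage to a quotient). [folklore] -/
theorem ContinuousRep.exists_factors_of_surjective {Γ G : Type*} [Group Γ] [TopologicalSpace Γ]
    [Group G] (ρ : ContinuousRep Γ A M) (r : Γ →* G) (hr : Function.Surjective r)
    (hker : ∀ γ, r γ = 1 → (ρ γ : M →ₗ[A] M) = 1) :
    ∃ τ : Representation A G M, ∀ γ, (ρ γ : M →ₗ[A] M) = τ (r γ) := by
  have htop : (⊤ : Subgroup G) ≤ r.range := by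
    rw [MonoidHom.range_eq_top.mpr hr]
  obtain ⟨τ₀, hτ₀⟩ := Representation.exists_factors_of_ker_le (⊤ : Subgroup G) r htop
    ρ.toRepresentation (fun γ hγ => by
      rw [MonoidHom.mem_ker] at hγ ⊢
      exact hker γ hγ)
  refine ⟨τ₀.comp (Subgroup.topEquiv (G := G)).symm.toMonoidHom, fun γ => ?_⟩
  rw [MonoidHom.comp_apply]
  change (ρ γ : M →ₗ[A] M) = τ₀ (Subgroup.topEquiv.symm (r γ))
  have : Subgroup.topEquiv.symm (r γ) = ⟨r γ, Subgroup.mem_top _⟩ := rfl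
  rw [this, hτ₀ γ (Subgroup.mem_top _)]
  rfl

/-- **The finite-level formula as a sum of natural numbers.**  In the situation of
`GaloisRep.artinConductorAt_eq_finsum_of_algHom`, if moreover `r₀ : Γ_F → Gal(E₀/F)` is surjective
and `ρ = τ ∘ r₀` for a representation `τ` of `G = Gal(E₀/F)`, and `G_i = 1` for `i ≥ N`, then
`#G₀ · a_𝔓(ρ) = Σ_{i<N} #Gᵢ · codim M^{Gᵢ}` (codimensions of the fixed spaces of `τ`; Serre's
`g₀ f(χ) = Σᵢ gᵢ codim V^{Gᵢ}`).
[cite: SerreLocalFields1979, Ch. VI §2, Cor. 1' to Prop. 2] -/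
theorem GaloisRep.card_mul_artinConductorAt_eq_natCast_sum_of_algHom
    (φ : E₀ →ₐ[F] AlgebraicClosure F) (r₀ : absoluteGaloisGroup F →* (E₀ ≃ₐ[F] E₀))
    (hr₀ : ∀ (γ : absoluteGaloisGroup F) (x : E₀), φ (r₀ γ x) = γ • φ x)
    (hsurj : Function.Surjective r₀)
    {v : HeightOneSpectrum (𝓞 F)} {𝔓 : Ideal (absIntegers (𝓞 F) F)} (h𝔓 : 𝔓 ∈ v.primesAbove)
    (ρ : GaloisRep F A M) (τ : Representation A (E₀ ≃ₐ[F] E₀) M)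
    (hτ : ∀ γ, (ρ γ : M →ₗ[A] M) = τ (r₀ γ)) {N : ℕ}
    (hN : ∀ i, N ≤ i →
      (𝔓.comap ((φ.restrictScalars (𝓞 F)).mapIntegralClosure.toRingHom :
            integralClosure (𝓞 F) E₀ →+* absIntegers (𝓞 F) F)).ramificationSubgroup
              (E₀ ≃ₐ[F] E₀) i = ⊥) :
    (Nat.card ((𝔓.comap ((φ.restrictScalars (𝓞 F)).mapIntegralClosure.toRingHom :
            integralClosure (𝓞 F) E₀ →+* absIntegers (𝓞 F) F)).ramificationSubgroup
              (E₀ ≃ₐ[F] E₀) 0) : ℝ) * ρ.artinConductorAt (𝓞 F) 𝔓 =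
      ((∑ i ∈ Finset.range N,
        Nat.card ((𝔓.comap ((φ.restrictScalars (𝓞 F)).mapIntegralClosure.toRingHom :
            integralClosure (𝓞 F) E₀ →+* absIntegers (𝓞 F) F)).ramificationSubgroup
              (E₀ ≃ₐ[F] E₀) i) *
          Representation.codimFixed τ
            ((𝔓.comap ((φ.restrictScalars (𝓞 F)).mapIntegralClosure.toRingHom :
              integralClosure (𝓞 F) E₀ →+* absIntegers (𝓞 F) F)).ramificationSubgroup
                (E₀ ≃ₐ[F] E₀) i) : ℕ) : ℝ) := by
  set P₀ : Ideal (integralClosure (𝓞 F) E₀) :=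
    𝔓.comap ((φ.restrictScalars (𝓞 F)).mapIntegralClosure.toRingHom :
      integralClosure (𝓞 F) E₀ →+* absIntegers (𝓞 F) F) with hP₀
  have hρ : ∀ γ : absoluteGaloisGroup F, r₀ γ = 1 → ρ γ = 1 := fun γ hγ => by
    have := hτ γ
    rw [hγ, map_one] at this
    exact this
  rw [GaloisRep.artinConductorAt_eq_finsum_of_algHom φ r₀ hr₀ h𝔓 ρ hρ]
  have hcodim : ∀ i, ρ.codimFixed ((P₀.ramificationSubgroup (E₀ ≃ₐ[F] E₀) i).comap r₀) =
      Representation.codimFixed τ (P₀.ramificationSubgroup (E₀ ≃ₐ[F] E₀) i) := fun i =>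
    ContinuousRep.codimFixed_comap_eq_of_surjective (ρ : ContinuousRep _ A M) r₀ hsurj τ hτ _
  -- the finite sum has support in `[0, N)`
  have hsupp : (Function.support fun i : ℕ =>
      ((Nat.card (P₀.ramificationSubgroup (E₀ ≃ₐ[F] E₀) i) : ℝ) /
          Nat.card (P₀.ramificationSubgroup (E₀ ≃ₐ[F] E₀) 0)) *
        ρ.codimFixed ((P₀.ramificationSubgroup (E₀ ≃ₐ[F] E₀) i).comap r₀)) ⊆
      (Finset.range N : Set ℕ) := by
    intro i hi
    rw [Function.mem_support] at hi
    rw [Finset.coe_range, Set.mem_Iio]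
    by_contra hle
    apply hi
    rw [hcodim i, hN i (not_lt.mp hle), codimFixed_bot, Nat.cast_zero, mul_zero]
  show (Nat.card (P₀.ramificationSubgroup (E₀ ≃ₐ[F] E₀) 0) : ℝ) *
      ∑ᶠ i : ℕ, ((Nat.card (P₀.ramificationSubgroup (E₀ ≃ₐ[F] E₀) i) : ℝ) /
          Nat.card (P₀.ramificationSubgroup (E₀ ≃ₐ[F] E₀) 0)) *
        ρ.codimFixed ((P₀.ramificationSubgroup (E₀ ≃ₐ[F] E₀) i).comap r₀) =
    ((∑ i ∈ Finset.range N, Nat.card (P₀.ramificationSubgroup (E₀ ≃ₐ[F] E₀) i) *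
        Representation.codimFixed τ (P₀.ramificationSubgroup (E₀ ≃ₐ[F] E₀) i) : ℕ) : ℝ)
  rw [finsum_eq_sum_of_support_subset _ hsupp, Finset.mul_sum, Nat.cast_sum]
  refine Finset.sum_congr rfl fun i _ => ?_
  have h0 : (Nat.card (P₀.ramificationSubgroup (E₀ ≃ₐ[F] E₀) 0) : ℝ) ≠ 0 := by
    haveI : Finite (P₀.ramificationSubgroup (E₀ ≃ₐ[F] E₀) 0) := inferInstance
    exact_mod_cast Nat.card_pos.ne'
  rw [hcodim i, Nat.cast_mul, ← mul_assoc, mul_div_cancel₀ _ h0]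

end AbstractFiniteLevel

/-! ### The numerator-form local Artin function and conjugation -/

section Local

variable {S : Type*} [CommRing S] {Γ : Type*} [Group Γ] [MulSemiringAction Γ S]

/-- `i_{τ𝔓}(τ s τ⁻¹) = i_𝔓(s)`: Serre's function `i_G` at a conjugate prime, evaluated at the
conjugate element (transport of the ramification filtration along the ring automorphism `τ`).
Ref: Serre, *Local Fields*, Ch. IV §1 (`i_G(tst⁻¹) = i_G(s)` for `t ∈ D`); Neukirch,
*Algebraic Number Theory*, Ch. I §9 (conjugate primes). [folklore] -/
theorem lowerIndex_smul_conj (𝔓 : Ideal S) (τ s : Γ) :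
    lowerIndex (τ • 𝔓) Γ (τ * s * τ⁻¹) = lowerIndex 𝔓 Γ s := by
  have he : ∀ (g : Γ) (x : S), MulSemiringAction.toRingEquiv Γ S τ (g • x) =
      (MulAut.conj τ).toMonoidHom g • MulSemiringAction.toRingEquiv Γ S τ x := by
    intro g x
    change τ • (g • x) = (τ * g * τ⁻¹) • (τ • x)
    rw [smul_smul, smul_smul, inv_mul_cancel_right]
  rw [lowerIndex_eq_of_equivariant (MulAut.conj τ).toMonoidHom (MulSemiringAction.toRingEquiv Γ S τ)
    he 𝔓 s]
  rfl

variable [Fintype Γ]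

/-- `Σ_t i_{τ𝔓}(t) = Σ_t i_𝔓(t)` (reindex by conjugation). [folklore] -/
theorem sum_lowerIndex_toNat_smul (𝔓 : Ideal S) (τ : Γ) :
    ∑ t : Γ, ((lowerIndex (τ • 𝔓) Γ t).toNat : ℂ) = ∑ t : Γ, ((lowerIndex 𝔓 Γ t).toNat : ℂ) := by
  refine Fintype.sum_equiv (MulAut.conj τ).toEquiv.symm _ _ fun t => ?_
  have : t = τ * ((MulAut.conj τ).toEquiv.symm t) * τ⁻¹ := by
    simp [MulAut.conj_symm_apply, mul_assoc]
  conv_lhs => rw [this]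
  rw [lowerIndex_smul_conj]

/-- **The numerator-form local Artin function is a class function on conjugate primes**:
with `a_𝔓(s) = Σ_t i_𝔓(t)` for `s = 1` and `a_𝔓(s) = -i_𝔓(s)` for `s ≠ 1` (Serre's `a_G` for the
decomposition group, multiplied by `#G₀ / f`, extended by `-i_𝔓 = 0` off the inertia group),
`a_{τ𝔓}(τ s τ⁻¹) = a_𝔓(s)`.
Ref: Serre, *Local Fields*, Ch. VI §2 (definition of `a_G`); Neukirch, *Algebraic Number Theory*,
VII §11, p. 533 (`a_𝔭 = Σ_{𝔓 ∣ 𝔭} a_𝔓` is a central function). [cite: NeukirchANT1999, VII §11 (p. 533)] -/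
theorem localArtin_smul_conj [DecidableEq Γ] (𝔓 : Ideal S) (τ s : Γ) :
    (if τ * s * τ⁻¹ = 1 then ∑ t : Γ, ((lowerIndex (τ • 𝔓) Γ t).toNat : ℂ)
      else -((lowerIndex (τ • 𝔓) Γ (τ * s * τ⁻¹)).toNat : ℂ)) =
    (if s = 1 then ∑ t : Γ, ((lowerIndex 𝔓 Γ t).toNat : ℂ)
      else -((lowerIndex 𝔓 Γ s).toNat : ℂ)) := by
  have h1 : τ * s * τ⁻¹ = 1 ↔ s = 1 := by
    constructor
    · intro h
      have := congrArg (fun x => τ⁻¹ * x * τ) h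
      simpa [mul_assoc] using this
    · rintro rfl; simp
  by_cases hs : s = 1
  · rw [if_pos (h1.mpr hs), if_pos hs, sum_lowerIndex_toNat_smul]
  · rw [if_neg (fun h => hs (h1.mp h)), if_neg hs, lowerIndex_smul_conj]

/-- **Pairing the local Artin function with a function**:
`Σ_s a_𝔓(s) χ(s) = Σ_s i_𝔓(s) (χ(1) - χ(s))` (the numerator form of Serre's `g₀ f(χ) = Σ a_G χ`;
the term `s = 1` on the right vanishes, and `i_𝔓(1)` enters nowhere).
Ref: Serre, *Local Fields*, Ch. VI §2, `f(χ) = (χ, a_G)` and Prop. 2. [cite: SerreLocalFields1979, Ch. VI §2 Prop. 2] -/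
theorem sum_localArtin_mul [DecidableEq Γ] (𝔓 : Ideal S) (χ : Γ → ℂ) :
    ∑ s : Γ, (if s = 1 then ∑ t : Γ, ((lowerIndex 𝔓 Γ t).toNat : ℂ)
      else -((lowerIndex 𝔓 Γ s).toNat : ℂ)) * χ s =
    ∑ s : Γ, ((lowerIndex 𝔓 Γ s).toNat : ℂ) * (χ 1 - χ s) := by
  have key : ∀ s : Γ, (if s = 1 then ∑ t : Γ, ((lowerIndex 𝔓 Γ t).toNat : ℂ)
      else -((lowerIndex 𝔓 Γ s).toNat : ℂ)) * χ s =
      (if s = 1 then (∑ t : Γ, ((lowerIndex 𝔓 Γ t).toNat : ℂ)) * χ 1 else 0) -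
        ((lowerIndex 𝔓 Γ s).toNat : ℂ) * χ s := by
    intro s
    by_cases hs : s = 1
    · subst hs
      rw [if_pos rfl, if_pos rfl, lowerIndex_one, ENat.toNat_top, Nat.cast_zero, zero_mul,
        sub_zero]
    · rw [if_neg hs, if_neg hs, zero_sub, neg_mul]
  simp_rw [key]
  rw [Finset.sum_sub_distrib, Finset.sum_ite_eq' Finset.univ (1 : Γ), if_pos (Finset.mem_univ _),
    Finset.sum_mul, ← Finset.sum_sub_distrib]
  refine Finset.sum_congr rfl fun s _ => ?_
  ring

/-- The numerator Artin sum `Σ_s i_𝔓(s)(χ(1) - χ(s))` of a class function is the same at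
conjugate primes. [folklore] -/
theorem sum_lowerIndex_mul_sub_smul (𝔓 : Ideal S) (τ : Γ) (χ : Γ → ℂ)
    (hχ : ∀ s t : Γ, χ (t * s * t⁻¹) = χ s) :
    ∑ s : Γ, ((lowerIndex (τ • 𝔓) Γ s).toNat : ℂ) * (χ 1 - χ s) =
      ∑ s : Γ, ((lowerIndex 𝔓 Γ s).toNat : ℂ) * (χ 1 - χ s) := by
  refine Fintype.sum_equiv (MulAut.conj τ).toEquiv.symm _ _ fun t => ?_
  have ht : t = τ * ((MulAut.conj τ).toEquiv.symm t) * τ⁻¹ := by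
    simp [MulAut.conj_symm_apply, mul_assoc]
  conv_lhs => rw [ht]
  rw [lowerIndex_smul_conj, hχ]

end Local

/-! ### The global Artin class function `A_𝔭 = Σ_{𝔓 ∣ 𝔭} f(𝔓|𝔭) a_𝔓` over a base ring -/

section ClassFun

variable {T S : Type*} [CommRing T] [IsDomain T] [CommRing S] [IsDedekindDomain S] [Algebra T S]
  [Module.IsTorsionFree T S]
  {Γ : Type*} [Group Γ] [Fintype Γ] [DecidableEq Γ] [MulSemiringAction Γ S] [SMulCommClass Γ T S]

omit [Fintype Γ] [DecidableEq Γ] in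
/-- Conjugates of primes over `𝔭` are primes over `𝔭` (membership in Mathlib's
`IsDedekindDomain.primesOverFinset`). [folklore] -/
theorem smul_mem_primesOverFinset {𝔭 : Ideal T} [𝔭.IsMaximal] (h𝔭 : 𝔭 ≠ ⊥) (τ : Γ)
    {𝔓 : Ideal S} (h𝔓 : 𝔓 ∈ IsDedekindDomain.primesOverFinset 𝔭 S) :
    τ • 𝔓 ∈ IsDedekindDomain.primesOverFinset 𝔭 S := by
  rw [IsDedekindDomain.mem_primesOverFinset_iff h𝔭] at h𝔓 ⊢
  obtain ⟨h1, h2⟩ := h𝔓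
  exact ⟨inferInstance, ⟨by rw [Ideal.under_smul]; exact h2.over⟩⟩

/-- **`A_𝔭` is a class function**: `A_𝔭(τ s τ⁻¹) = A_𝔭(s)` for
`A_𝔭(s) = Σ_{𝔓 ∣ 𝔭} f(𝔓|𝔭) a_𝔓(s)` (the primes over `𝔭` are permuted by `τ`, `f` and `a` are
equivariant).  Ref: Neukirch, *Algebraic Number Theory*, VII §11, p. 533 ("the central function
`a_𝔭 = Σ_{𝔓 ∣ 𝔭} a_𝔓`"). [cite: NeukirchANT1999, VII §11 (p. 533)] -/
theorem artinClassFun_conj {𝔭 : Ideal T} [𝔭.IsMaximal] (h𝔭 : 𝔭 ≠ ⊥) (τ s : Γ) :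
    ∑ 𝔓 ∈ IsDedekindDomain.primesOverFinset 𝔭 S, (𝔓.inertiaDeg T : ℂ) *
      (if τ * s * τ⁻¹ = 1 then ∑ t : Γ, ((lowerIndex 𝔓 Γ t).toNat : ℂ)
        else -((lowerIndex 𝔓 Γ (τ * s * τ⁻¹)).toNat : ℂ)) =
    ∑ 𝔓 ∈ IsDedekindDomain.primesOverFinset 𝔭 S, (𝔓.inertiaDeg T : ℂ) *
      (if s = 1 then ∑ t : Γ, ((lowerIndex 𝔓 Γ t).toNat : ℂ)
        else -((lowerIndex 𝔓 Γ s).toNat : ℂ)) := by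
  symm
  refine Finset.sum_bij' (fun 𝔓 _ => τ • 𝔓) (fun 𝔓 _ => τ⁻¹ • 𝔓)
    (fun 𝔓 h𝔓 => smul_mem_primesOverFinset h𝔭 τ h𝔓)
    (fun 𝔓 h𝔓 => smul_mem_primesOverFinset h𝔭 τ⁻¹ h𝔓)
    (fun 𝔓 _ => inv_smul_smul τ 𝔓) (fun 𝔓 _ => smul_inv_smul τ 𝔓) (fun 𝔓 _ => ?_)
  rw [Ideal.inertiaDeg_smul, localArtin_smul_conj]

variable [IsGaloisGroup Γ T S]

omit [SMulCommClass Γ T S] in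
/-- **Pairing a class function with `A_𝔭`** (Serre's `f(χ) = (χ, a_G)` in the global numerator
form): for `Γ` a finite Galois group of `S/T`, `𝔭` a nonzero maximal ideal of `T`, `𝔓 ∣ 𝔭` with
separable residue extension and `χ` a class function on `Γ`,
`#I_𝔓 · Σ_s A_𝔭(s) χ(s) = #Γ · Σ_s i_𝔓(s)(χ(1) - χ(s))`: all primes over `𝔭` are conjugate to `𝔓`
(Mathlib `Algebra.IsInvariant.exists_smul_of_under_eq`) and contribute the same amount, and
`#{𝔓' ∣ 𝔭} · #I_𝔓 · f(𝔓|𝔭) = #Γ`.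
Ref: Serre, *Local Fields*, Ch. VI §2, Cor. 1 to Prop. 2 with Prop. 1; Neukirch, *Algebraic Number
Theory*, VII §11, `f(χ, 𝔭) = (χ, a_𝔭)`. [cite: NeukirchANT1999, VII §11 (p. 533)]
[cite: SerreLocalFields1979, Ch. VI §2 Prop. 1–2] -/
theorem card_inertia_mul_sum_artinClassFun_mul {𝔭 : Ideal T} [𝔭.IsMaximal] (h𝔭 : 𝔭 ≠ ⊥)
    (𝔓 : Ideal S) [𝔓.IsMaximal] [𝔓.LiesOver 𝔭] [Algebra.IsSeparable (T ⧸ 𝔭) (S ⧸ 𝔓)]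
    (χ : Γ → ℂ) (hχ : ∀ s t : Γ, χ (t * s * t⁻¹) = χ s) :
    (Nat.card (𝔓.inertia Γ) : ℂ) * ∑ s : Γ, (∑ 𝔓' ∈ IsDedekindDomain.primesOverFinset 𝔭 S,
      (𝔓'.inertiaDeg T : ℂ) * (if s = 1 then ∑ t : Γ, ((lowerIndex 𝔓' Γ t).toNat : ℂ)
        else -((lowerIndex 𝔓' Γ s).toNat : ℂ))) * χ s =
    (Fintype.card Γ : ℂ) * ∑ s : Γ, ((lowerIndex 𝔓 Γ s).toNat : ℂ) * (χ 1 - χ s) := by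
  haveI : SMulCommClass Γ T S := IsGaloisGroup.commutes (G := Γ) (A := T) (B := S)
  -- exchange the sums and evaluate the inner pairing
  have h1 : ∑ s : Γ, (∑ 𝔓' ∈ IsDedekindDomain.primesOverFinset 𝔭 S,
      (𝔓'.inertiaDeg T : ℂ) * (if s = 1 then ∑ t : Γ, ((lowerIndex 𝔓' Γ t).toNat : ℂ)
        else -((lowerIndex 𝔓' Γ s).toNat : ℂ))) * χ s =
      ∑ 𝔓' ∈ IsDedekindDomain.primesOverFinset 𝔭 S, (𝔓'.inertiaDeg T : ℂ) *
        ∑ s : Γ, ((lowerIndex 𝔓' Γ s).toNat : ℂ) * (χ 1 - χ s) := by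
    simp_rw [Finset.sum_mul]
    rw [Finset.sum_comm]
    refine Finset.sum_congr rfl fun 𝔓' _ => ?_
    simp_rw [mul_assoc]
    rw [← Finset.mul_sum, sum_localArtin_mul]
  -- every prime over `𝔭` is conjugate to `𝔓` and contributes the same
  have h2 : ∀ 𝔓' ∈ IsDedekindDomain.primesOverFinset 𝔭 S, (𝔓'.inertiaDeg T : ℂ) *
        ∑ s : Γ, ((lowerIndex 𝔓' Γ s).toNat : ℂ) * (χ 1 - χ s) =
      (𝔓.inertiaDeg T : ℂ) * ∑ s : Γ, ((lowerIndex 𝔓 Γ s).toNat : ℂ) * (χ 1 - χ s) := by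
    intro 𝔓' h𝔓'
    rw [IsDedekindDomain.mem_primesOverFinset_iff h𝔭] at h𝔓'
    obtain ⟨hprime, hover⟩ := h𝔓'
    obtain ⟨τ, rfl⟩ := Algebra.IsInvariant.exists_smul_of_under_eq T S Γ 𝔓 𝔓'
      ((Ideal.LiesOver.over (P := 𝔓) (p := 𝔭)).symm.trans hover.over)
    rw [Ideal.inertiaDeg_smul, sum_lowerIndex_mul_sub_smul 𝔓 τ χ hχ]
  rw [h1, Finset.sum_congr rfl h2, Finset.sum_const, nsmul_eq_mul, ← mul_assoc, ← mul_assoc]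
  congr 1
  -- `#{𝔓' ∣ 𝔭} · #I_𝔓 · f = #Γ`
  have hcount : (IsDedekindDomain.primesOverFinset 𝔭 S).card = (𝔭.primesOver S).ncard := by
    rw [← IsDedekindDomain.coe_primesOverFinset h𝔭 S, Set.ncard_coe_finset]
  have key := ncard_primesOver_mul_card_inertia_mul_inertiaDeg_of_isSeparable (G := Γ) 𝔭 𝔓
  rw [← Nat.card_eq_fintype_card, ← key, hcount]
  push_cast
  ring

end ClassFun

/-! ### Restricting `A_𝔭` to a subgroup: partition of the primes over `𝔭` along a tower -/

section Restriction

variable {T B S : Type*} [CommRing T] [IsDomain T] [CommRing B] [IsDedekindDomain B] [CommRing S]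
  [IsDedekindDomain S] [Algebra T B] [Algebra B S] [Algebra T S] [IsScalarTower T B S]
  [Module.IsTorsionFree T B] [Module.IsTorsionFree T S] [Module.IsTorsionFree B S]
  [Algebra.IsIntegral T B]
  {Γ : Type*} [Group Γ] [Fintype Γ] [DecidableEq Γ] [MulSemiringAction Γ S]
  (Δ : Subgroup Γ) [DecidablePred (· ∈ Δ)]

omit [IsDomain T] [Module.IsTorsionFree T B] [Module.IsTorsionFree T S]
  [Module.IsTorsionFree B S] in
/-- A prime of `B` over a maximal ideal `𝔭` of `T` (`B ⊇ T` integral) occurring in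
`primesOverFinset 𝔭 B` is a nonzero maximal ideal. [folklore] -/
theorem ne_bot_and_isMaximal_of_mem_primesOverFinset {𝔭 : Ideal T} [𝔭.IsMaximal]
    {𝔮 : Ideal B} (h𝔮 : 𝔮 ∈ IsDedekindDomain.primesOverFinset 𝔭 B) : 𝔮 ≠ ⊥ ∧ 𝔮.IsMaximal := by
  classical
  have hmem : 𝔮 ∈ (UniqueFactorizationMonoid.factors (𝔭.map (algebraMap T B))).toFinset := h𝔮
  rw [Multiset.mem_toFinset] at hmem
  have hprime : Prime 𝔮 := UniqueFactorizationMonoid.prime_of_factor _ hmem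
  haveI : 𝔮.IsPrime := Ideal.isPrime_of_prime hprime
  have hne : 𝔮 ≠ ⊥ := hprime.ne_zero
  have hdvd : 𝔮 ∣ 𝔭.map (algebraMap T B) := UniqueFactorizationMonoid.dvd_of_mem_factors hmem
  have hle : 𝔭 ≤ 𝔮.under T := by
    rw [← Ideal.map_le_iff_le_comap]
    exact Ideal.le_of_dvd hdvd
  have hunder : 𝔮.under T = 𝔭 :=
    ((Ideal.IsMaximal.eq_of_le inferInstance (Ideal.IsPrime.ne_top inferInstance) hle)).symm
  refine ⟨hne, Ideal.isMaximal_of_isIntegral_of_isMaximal_comap (R := T) 𝔮 ?_⟩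
  rw [← Ideal.under_def, hunder]
  infer_instance

omit [Module.IsTorsionFree T S] [Module.IsTorsionFree B S] [Algebra.IsIntegral T B] in
/-- Membership in `primesOverFinset 𝔭 B`: prime and lying over `𝔭`. [folklore] -/
theorem mem_primesOverFinset_iff' {𝔭 : Ideal T} [𝔭.IsMaximal] (h𝔭 : 𝔭 ≠ ⊥) {𝔮 : Ideal B} :
    𝔮 ∈ IsDedekindDomain.primesOverFinset 𝔭 B ↔ 𝔮.IsPrime ∧ 𝔮.under T = 𝔭 := by
  rw [IsDedekindDomain.mem_primesOverFinset_iff h𝔭]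
  exact ⟨fun ⟨h1, h2⟩ => ⟨h1, h2.over.symm⟩, fun ⟨h1, h2⟩ => ⟨h1, ⟨h2.symm⟩⟩⟩

omit [Module.IsTorsionFree T S] in
/-- **The primes of `S` over `𝔭` are partitioned by the primes of `B` over `𝔭`**: for a tower
`T ⊆ B ⊆ S` and a nonzero maximal `𝔭 ⊆ T`, summing over the primes `𝔓 ∣ 𝔭` of `S` is summing over
the primes `𝔮 ∣ 𝔭` of `B` and then over the primes `𝔓 ∣ 𝔮` of `S`.
Ref: Neukirch, *Algebraic Number Theory*, Ch. I §9 / VII §11 proof of (11.7) (iii) ("`𝔓'_τ` are the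
different prime ideals of `K'` above `𝔭`"). [folklore] -/
theorem sum_primesOverFinset_eq_sum_sum {𝔭 : Ideal T} [𝔭.IsMaximal] (h𝔭 : 𝔭 ≠ ⊥)
    (hTS : ∀ 𝔓 : Ideal S, 𝔓.IsPrime → (𝔓.under B).under T = 𝔓.under T) (g : Ideal S → ℂ) :
    ∑ 𝔓 ∈ IsDedekindDomain.primesOverFinset 𝔭 S, g 𝔓 =
      ∑ 𝔮 ∈ IsDedekindDomain.primesOverFinset 𝔭 B,
        ∑ 𝔓 ∈ IsDedekindDomain.primesOverFinset 𝔮 S, g 𝔓 := by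
  classical
  haveI : Module.IsTorsionFree T S := by
    refine Module.IsTorsionFree.of_smul_eq_zero fun r m h ↦ ?_
    rwa [algebra_compatible_smul B, smul_eq_zero, FaithfulSMul.algebraMap_eq_zero_iff] at h
  rw [← Finset.sum_biUnion]
  · refine Finset.sum_congr ?_ fun _ _ => rfl
    ext 𝔓
    rw [Finset.mem_biUnion, mem_primesOverFinset_iff' h𝔭]
    constructor
    · rintro ⟨h1, h2⟩
      haveI := h1
      have hq : 𝔓.under B ∈ IsDedekindDomain.primesOverFinset 𝔭 B := by
        rw [mem_primesOverFinset_iff' h𝔭]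
        exact ⟨inferInstance, by rw [hTS 𝔓 h1, h2]⟩
      obtain ⟨hqne, hqmax⟩ := ne_bot_and_isMaximal_of_mem_primesOverFinset hq
      haveI := hqmax
      exact ⟨𝔓.under B, hq, (mem_primesOverFinset_iff' hqne).mpr ⟨h1, rfl⟩⟩
    · rintro ⟨𝔮, h𝔮, h𝔓⟩
      obtain ⟨hqne, hqmax⟩ := ne_bot_and_isMaximal_of_mem_primesOverFinset h𝔮
      haveI := hqmax
      rw [mem_primesOverFinset_iff' hqne] at h𝔓
      obtain ⟨h1, h2⟩ := h𝔓
      refine ⟨h1, ?_⟩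
      rw [← hTS 𝔓 h1, h2]
      exact ((mem_primesOverFinset_iff' h𝔭).mp h𝔮).2
  · intro 𝔮 h𝔮 𝔮' h𝔮' hne
    obtain ⟨hqne, hqmax⟩ := ne_bot_and_isMaximal_of_mem_primesOverFinset (Finset.mem_coe.mp h𝔮)
    obtain ⟨hqne', hqmax'⟩ :=
      ne_bot_and_isMaximal_of_mem_primesOverFinset (Finset.mem_coe.mp h𝔮')
    haveI := hqmax
    haveI := hqmax'
    rw [Function.onFun, Finset.disjoint_left]
    intro 𝔓 h1 h2
    apply hne
    rw [mem_primesOverFinset_iff' hqne] at h1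
    rw [mem_primesOverFinset_iff' hqne'] at h2
    rw [← h1.2, ← h2.2]

omit [IsDomain T] [IsDedekindDomain B] [IsDedekindDomain S] [Algebra T B] [Algebra T S] [IsScalarTower T B S]
  [Module.IsTorsionFree T B] [Module.IsTorsionFree T S] [Module.IsTorsionFree B S]
  [Algebra.IsIntegral T B] in
/-- **The local Artin function of `Γ` restricted to a subgroup `Δ`**:
`a^Γ_𝔓(h) = a^Δ_𝔓(h) + [h = 1] · Σ_{t ∉ Δ} i_𝔓(t)` for `h ∈ Δ` (`i_Δ = i_Γ` on `Δ`, Serre IV §1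
Prop. 2; at `h = 1` the sum over `Γ` splits into `Δ` and its complement).
Ref: Serre, *Local Fields*, Ch. IV §1 Prop. 2 and Ch. VI §2 Prop. 4 (proof).
[cite: SerreLocalFields1979, Ch. IV §1 Prop. 2] -/
theorem localArtin_eq_localArtin_subgroup_add (𝔓 : Ideal S) {h : Γ} (hh : h ∈ Δ) :
    (if h = 1 then ∑ t : Γ, ((lowerIndex 𝔓 Γ t).toNat : ℂ) else -((lowerIndex 𝔓 Γ h).toNat : ℂ)) =
      (if (⟨h, hh⟩ : Δ) = 1 then ∑ t : Δ, ((lowerIndex 𝔓 Δ t).toNat : ℂ)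
        else -((lowerIndex 𝔓 Δ ⟨h, hh⟩).toNat : ℂ)) +
      (if h = 1 then ∑ t ∈ Finset.univ.filter (· ∉ Δ), ((lowerIndex 𝔓 Γ t).toNat : ℂ) else 0) := by
  by_cases h1 : h = 1
  · subst h1
    have h1' : (⟨1, hh⟩ : Δ) = 1 := rfl
    rw [if_pos rfl, if_pos h1', if_pos rfl]
    rw [← Finset.sum_filter_add_sum_filter_not Finset.univ (· ∈ Δ)]
    congr 1
    rw [Finset.sum_subtype (Finset.univ.filter (· ∈ Δ)) (p := (· ∈ Δ)) (fun t => by simp)]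
    exact Finset.sum_congr rfl fun t _ => by rw [lowerIndex_subgroup]
  · have h1' : (⟨h, hh⟩ : Δ) ≠ 1 := fun e => h1 (congrArg Subtype.val e)
    rw [if_neg h1, if_neg h1', if_neg h1, add_zero, lowerIndex_subgroup]

omit [Module.IsTorsionFree T S] in
/-- **Restriction of the Artin class function to a subgroup** (the heart of Neukirch VII
(11.7) (iii) / Serre VI §2 Prop. 4 in global numerator form).  Let `T ⊆ B ⊆ S` be a tower,
`Γ` acting on `S` with `f` multiplicative in the tower, `Δ ≤ Γ`, `𝔭` a nonzero maximal ideal of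
`T`.  Then for `h ∈ Δ`:
`A^Γ_𝔭(h) = Σ_{𝔮 ∣ 𝔭} f(𝔮|𝔭) · ( A^Δ_𝔮(h) + [h = 1] · Σ_{𝔓 ∣ 𝔮} f(𝔓|𝔮) Σ_{t ∉ Δ} i_𝔓(t) )`,
where `A^Γ_𝔭 = Σ_{𝔓 ∣ 𝔭} f(𝔓|𝔭) a^Γ_𝔓` and `A^Δ_𝔮 = Σ_{𝔓 ∣ 𝔮} f(𝔓|𝔮) a^Δ_𝔓` (partition of the
primes `𝔓 ∣ 𝔭` by `𝔮 = 𝔓 ∩ B`, `f(𝔓|𝔭) = f(𝔮|𝔭) f(𝔓|𝔮)`, and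
`localArtin_eq_localArtin_subgroup_add`).
Ref: Neukirch, *Algebraic Number Theory*, VII (11.7) (iii), proof; Serre, *Local Fields*, Ch. VI
§2 Prop. 4. [cite: NeukirchANT1999, VII (11.7) (iii) proof] [cite: SerreLocalFields1979, Ch. VI §2 Prop. 4] -/
theorem artinClassFun_eq_sum_sub {𝔭 : Ideal T} [𝔭.IsMaximal] (h𝔭 : 𝔭 ≠ ⊥)
    (hTS : ∀ 𝔓 : Ideal S, 𝔓.IsPrime → (𝔓.under B).under T = 𝔓.under T)
    (hf : ∀ (𝔮 : Ideal B) (𝔓 : Ideal S), 𝔓.IsPrime → 𝔓.under B = 𝔮 →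
      𝔓.inertiaDeg T = 𝔮.inertiaDeg T * 𝔓.inertiaDeg B)
    {h : Γ} (hh : h ∈ Δ) :
    ∑ 𝔓 ∈ IsDedekindDomain.primesOverFinset 𝔭 S, (𝔓.inertiaDeg T : ℂ) *
      (if h = 1 then ∑ t : Γ, ((lowerIndex 𝔓 Γ t).toNat : ℂ) else -((lowerIndex 𝔓 Γ h).toNat : ℂ)) =
    ∑ 𝔮 ∈ IsDedekindDomain.primesOverFinset 𝔭 B, (𝔮.inertiaDeg T : ℂ) *
      (∑ 𝔓 ∈ IsDedekindDomain.primesOverFinset 𝔮 S, (𝔓.inertiaDeg B : ℂ) *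
          (if (⟨h, hh⟩ : Δ) = 1 then ∑ t : Δ, ((lowerIndex 𝔓 Δ t).toNat : ℂ)
            else -((lowerIndex 𝔓 Δ ⟨h, hh⟩).toNat : ℂ)) +
        (if h = 1 then ∑ 𝔓 ∈ IsDedekindDomain.primesOverFinset 𝔮 S, (𝔓.inertiaDeg B : ℂ) *
          ∑ t ∈ Finset.univ.filter (· ∉ Δ), ((lowerIndex 𝔓 Γ t).toNat : ℂ) else 0)) := by
  rw [sum_primesOverFinset_eq_sum_sum (B := B) h𝔭 hTS]
  refine Finset.sum_congr rfl fun 𝔮 h𝔮 => ?_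
  obtain ⟨hqne, hqmax⟩ := ne_bot_and_isMaximal_of_mem_primesOverFinset h𝔮
  haveI := hqmax
  -- inside the fibre of `𝔮`: `f(𝔓|𝔭) = f(𝔮|𝔭) f(𝔓|𝔮)` and the local functions split
  have hterm : ∀ 𝔓 ∈ IsDedekindDomain.primesOverFinset 𝔮 S, (𝔓.inertiaDeg T : ℂ) *
      (if h = 1 then ∑ t : Γ, ((lowerIndex 𝔓 Γ t).toNat : ℂ) else -((lowerIndex 𝔓 Γ h).toNat : ℂ)) =
      (𝔮.inertiaDeg T : ℂ) * ((𝔓.inertiaDeg B : ℂ) *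
        ((if (⟨h, hh⟩ : Δ) = 1 then ∑ t : Δ, ((lowerIndex 𝔓 Δ t).toNat : ℂ)
            else -((lowerIndex 𝔓 Δ ⟨h, hh⟩).toNat : ℂ)) +
          (if h = 1 then ∑ t ∈ Finset.univ.filter (· ∉ Δ), ((lowerIndex 𝔓 Γ t).toNat : ℂ)
            else 0))) := by
    intro 𝔓 h𝔓
    obtain ⟨h1, h2⟩ := (mem_primesOverFinset_iff' hqne).mp h𝔓
    rw [hf 𝔮 𝔓 h1 h2, Nat.cast_mul, localArtin_eq_localArtin_subgroup_add Δ 𝔓 hh]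
    ring
  rw [Finset.sum_congr rfl hterm, ← Finset.mul_sum]
  congr 1
  simp_rw [mul_add, Finset.sum_add_distrib]
  congr 1
  by_cases h1 : h = 1
  · simp only [if_pos h1]
  · simp only [if_neg h1, mul_zero, Finset.sum_const_zero]

end Restriction

/-! ### The different of an intermediate field and Serre's `i_G` off the subgroup -/

section Different

attribute [local instance] Ideal.Quotient.field FractionRing.liftAlgebra
  FractionRing.isScalarTower_liftAlgebra

/-- **An unramified prime does not divide the different** (Dedekind; Mathlib
`not_dvd_differentIdeal_iff`, `Ideal.ramificationIdx_eq_one_iff`), in the form used below: for a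
finite extension of Dedekind domains `A ⊆ B` with separable fraction fields, a prime `P` of `B`
with finite residue field below it and `e(P | P ∩ A) = 1` has `v_P(𝔇_{B/A}) = 0`.
Ref: Serre, *Local Fields*, Ch. III §5 Thm. 1. [cite: SerreLocalFields1979, Ch. III §5 Thm. 1] -/
theorem emultiplicity_differentIdeal_eq_zero_of_ramificationIdx_eq_one {A B : Type*} [CommRing A]
    [CommRing B] [IsDedekindDomain A] [IsDedekindDomain B] [Algebra A B] [Module.Finite A B]
    [Module.IsTorsionFree A B] [Algebra.IsSeparable (FractionRing A) (FractionRing B)]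
    (P : Ideal B) [P.IsPrime] [Finite (A ⧸ P.under A)] (he : P.ramificationIdx A = 1) :
    emultiplicity P (differentIdeal A B) = 0 := by
  rw [emultiplicity_eq_zero, not_dvd_differentIdeal_iff, ← Ideal.ramificationIdx_eq_one_iff]
  exact he

variable (R : Type*) {K L : Type*} [CommRing R] [IsDedekindDomain R] [Field K] [Field L]
  [Algebra R K] [IsFractionRing R K] [Algebra R L] [Algebra K L] [IsScalarTower R K L]
  [FiniteDimensional K L] [IsGalois K L]

attribute [local instance] integralClosureAlgebra integralClosure_isScalarTower_left
  integralClosure_isScalarTower_bot integralClosure_faithfulSMul integralClosure_isIntegral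
  integralClosure_isTorsionFree isMaximal_under_integralClosure under_integralClosure_liesOver
  residueAlgebra residueSMul isScalarTower_residue

attribute [local instance] integralClosure_moduleFinite

omit [IsDedekindDomain R] [IsFractionRing R K] [FiniteDimensional K L] [IsGalois K L] in
/-- The inertia subgroup of `𝔓` in a subgroup `Γ ≤ G` has the cardinality of `Γ ⊓ T_𝔓`. [folklore] -/
theorem card_inertia_subgroup_eq (Γ : Subgroup (L ≃ₐ[K] L)) (𝔓 : Ideal (integralClosure R L)) :
    Nat.card (𝔓.inertia Γ) = Nat.card ↥(Γ ⊓ 𝔓.inertia (L ≃ₐ[K] L)) := by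
  rw [Nat.card_congr ((𝔓.inertia Γ).equivMapOfInjective Γ.subtype Γ.subtype_injective).toEquiv,
    AddSubgroup.inertia_map_subtype 𝔓.toAddSubgroup Γ, inf_comm]

set_option maxHeartbeats 1600000 in
/-- **`e · v_{𝔓_F}(𝔇_{S_F/R}) = Σ_{s ∉ H} i_G(s)`** (Serre, *Local Fields*, Ch. IV §1, Cor. to Prop. 4:
`v_{K'}(𝔇_{K'/K}) = (1/e') Σ_{s ∉ H} i_G(s)`, globalised to an arbitrary prime of a Galois
extension of Dedekind domains).  `R` Dedekind with fraction field `K`, `L/K` finite Galois with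
group `G`, `S = integralClosure R L`, `F` an intermediate field with `H = Gal(L/F)`,
`S_F = integralClosure R F`, `𝔓 ≠ 0` a maximal ideal of `S` with finite residue field,
`𝔓_F = 𝔓 ∩ S_F`, `e = e(𝔓 | 𝔓_F) = #(T_𝔓 ∩ H)`.  Then
`#(T_𝔓 ∩ H) · v_{𝔓_F}(𝔇_{S_F/R}) = Σ_{s ∈ G, s ∉ H} i_G(s)`.
Proof: with `D = D_𝔓`, `Z = L^D`, `Z' = L^{H ∩ D}`: `v_𝔓(𝔇_{S/R}) = Σ_{s ∈ D, s≠1} i_G(s) + e(𝔓|𝔓_Z) v_{𝔓_Z}(𝔇_{S_Z/R})`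
and `v_𝔓(𝔇_{S/R}) = Σ_{s ∈ H ∩ D, s≠1} i_G(s) + e(𝔓|𝔓_{Z'}) v_{𝔓_{Z'}}(𝔇_{S_{Z'}/R})`
(`emultiplicity_differentIdeal_eq_finsum_add_card_mul`); `𝔓_Z` is unramified over `R` and `𝔓_{Z'}`
is unramified over `S_F` (ramification indices multiply and `e(𝔓|𝔓_Z) = #T_𝔓 = e(𝔓|𝔭)`,
`e(𝔓|𝔓_{Z'}) = #(T_𝔓 ∩ H) = e(𝔓|𝔓_F)`), so `v_{𝔓_Z}(𝔇_{S_Z/R}) = 0` and, by transitivity along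
`R → S_F → S_{Z'}`, `v_{𝔓_{Z'}}(𝔇_{S_{Z'}/R}) = v_{𝔓_F}(𝔇_{S_F/R})`; subtract, and note `i_G = 0`
off `D`. [cite: SerreLocalFields1979, Ch. IV §1, Cor. to Prop. 4] -/
theorem card_inertia_mul_emultiplicity_differentIdeal_under_eq_sum_lowerIndex
    [IsDedekindDomain (integralClosure R L)] [Module.IsTorsionFree R (integralClosure R L)]
    (F : IntermediateField K L) [IsDedekindDomain (integralClosure R F)]
    [Module.IsTorsionFree R (integralClosure R F)] [CharZero R] [CharZero L]
    [Fintype (L ≃ₐ[K] L)] [DecidablePred (· ∈ F.fixingSubgroup)]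
    (𝔓 : Ideal (integralClosure R L)) [𝔓.IsMaximal] (h𝔓 : 𝔓 ≠ ⊥)
    [Finite (integralClosure R L ⧸ 𝔓)] :
    (Nat.card (𝔓.inertia F.fixingSubgroup) : ℕ∞) *
        emultiplicity (𝔓.under (integralClosure R F)) (differentIdeal R (integralClosure R F)) =
      ∑ s ∈ Finset.univ.filter (· ∉ F.fixingSubgroup), lowerIndex 𝔓 (L ≃ₐ[K] L) s := by
  classical
  haveI h𝔓prime : 𝔓.IsPrime := Ideal.IsMaximal.isPrime inferInstance
  haveI : FaithfulSMul (L ≃ₐ[K] L) (integralClosure R L) := faithfulSMul_algEquiv_integralClosure R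
  haveI : IsFractionRing (integralClosure R L) L :=
    integralClosure.isFractionRing_of_finite_extension K L
  haveI : (𝔓.under R).IsMaximal := Ideal.IsMaximal.under R 𝔓
  haveI : Algebra.IsSeparable (R ⧸ 𝔓.under R) (integralClosure R L ⧸ 𝔓) :=
    isSeparable_residue_of_finite 𝔓
  haveI : Finite (R ⧸ 𝔓.under R) := Finite.of_injective _ Ideal.algebraMap_quotient_injective
  haveI : Module.Finite R (integralClosure R L) :=
    IsIntegralClosure.finite R K L (integralClosure R L)
  haveI : FaithfulSMul R (integralClosure R L) := faithfulSMul_integralClosure R (K := K) (L := L)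
  haveI : IsGaloisGroup (L ≃ₐ[K] L) R (integralClosure R L) :=
    IsGaloisGroup.of_isFractionRing _ _ _ K L
  -- the groups
  set D : Subgroup (L ≃ₐ[K] L) := 𝔓.decompositionSubgroup (L ≃ₐ[K] L) with hD
  set I : Subgroup (L ≃ₐ[K] L) := 𝔓.inertia (L ≃ₐ[K] L) with hI
  have hID : I ≤ D := Ideal.inertia_le_stabilizer 𝔓
  obtain ⟨Nb, hNb⟩ := Ideal.ramificationSubgroup_eventually_eq_bot_holds 𝔓 (L ≃ₐ[K] L)
    (Ideal.IsMaximal.ne_top inferInstance)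
  have hfin : ∀ s : L ≃ₐ[K] L, s ≠ 1 → lowerIndex 𝔓 (L ≃ₐ[K] L) s ≠ ⊤ := fun s hs =>
    lowerIndex_ne_top 𝔓 (hNb Nb le_rfl) hs
  -- the fields `Z = L^D`, `Z' = L^{F.fixingSubgroup ∩ D}`
  set F₁ : IntermediateField K L := IntermediateField.fixedField D with hF₁
  set F₂ : IntermediateField K L := IntermediateField.fixedField (F.fixingSubgroup ⊓ D) with hF₂
  have hΓ₁ : F₁.fixingSubgroup = D := IntermediateField.fixingSubgroup_fixedField D
  have hΓ₂ : F₂.fixingSubgroup = F.fixingSubgroup ⊓ D := IntermediateField.fixingSubgroup_fixedField _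
  have hle : F ≤ F₂ := by
    rw [hF₂, IntermediateField.le_iff_le]
    exact inf_le_left
  haveI : IsDedekindDomain (integralClosure R F₁) := integralClosure.isDedekindDomain R K F₁
  haveI : IsDedekindDomain (integralClosure R F₂) := integralClosure.isDedekindDomain R K F₂
  haveI : Module.IsTorsionFree R (integralClosure R F₁) := by
    rw [Module.isTorsionFree_iff_faithfulSMul]
    exact faithfulSMul_integralClosure R (K := K) (L := F₁)
  haveI : Module.IsTorsionFree R (integralClosure R F₂) := by
    rw [Module.isTorsionFree_iff_faithfulSMul]
    exact faithfulSMul_integralClosure R (K := K) (L := F₂)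
  -- `e(𝔓 | 𝔭) = #T_𝔓` and the ramification indices over the intermediate fields
  have heR : 𝔓.ramificationIdx R = Nat.card I := by
    rw [← Ideal.ramificationIdxIn_eq_ramificationIdx (𝔓.under R) 𝔓 (L ≃ₐ[K] L),
      card_inertia_eq_ramificationIdxIn_of_isSeparable (G := L ≃ₐ[K] L) (𝔓.under R) 𝔓]
  have heF : ∀ F' : IntermediateField K L, [IsDedekindDomain (integralClosure R F')] →
      𝔓.ramificationIdx (integralClosure R F') = Nat.card ↥(F'.fixingSubgroup ⊓ I) := by
    intro F' _
    have hp : 𝔓.under (integralClosure R F') ≠ ⊥ := Ideal.IsIntegral.comap_ne_bot _ h𝔓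
    rw [← Ideal.ramificationIdx'_eq_ramificationIdx _ 𝔓 hp,
      ramificationIdx'_under_eq_card_inertia R F' 𝔓 h𝔓, card_inertia_subgroup_eq R]
  have hDI : D ⊓ I = I := inf_eq_right.mpr hID
  have hHDI : F.fixingSubgroup ⊓ D ⊓ I = F.fixingSubgroup ⊓ I := by rw [inf_assoc, hDI]
  -- `e(𝔓_Z | 𝔭) = 1`, hence `v_{𝔓_Z}(𝔇_{S_Z/R}) = 0`
  have he₁ : (𝔓.under (integralClosure R F₁)).ramificationIdx R = 1 := by
    have ht := Ideal.ramificationIdx_tower (R := R) (𝔓.under (integralClosure R F₁)) 𝔓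
    rw [heR, heF F₁, hΓ₁, hDI] at ht
    exact (Nat.eq_of_mul_eq_mul_right Nat.card_pos ((one_mul _).trans ht)).symm
  have hm₁ : emultiplicity (𝔓.comap (F₁.integralClosureInclusion R))
      (differentIdeal R (integralClosure R F₁)) = 0 := by
    have hcomap : 𝔓.comap (F₁.integralClosureInclusion R) = 𝔓.under (integralClosure R F₁) :=
      Ideal.ext fun _ => Iff.rfl
    rw [hcomap]
    haveI : Finite (R ⧸ (𝔓.under (integralClosure R F₁)).under R) := by
      rw [Ideal.under_under]; infer_instance
    haveI : Module.Finite R (integralClosure R F₁) :=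
      IsIntegralClosure.finite R K F₁ (integralClosure R F₁)
    exact emultiplicity_differentIdeal_eq_zero_of_ramificationIdx_eq_one _ he₁
  -- the two instances of `emultiplicity_differentIdeal_eq_finsum_add_card_mul`
  have H1 := emultiplicity_differentIdeal_eq_finsum_add_card_mul R F₁ 𝔓 h𝔓 hΓ₁.le
  rw [hm₁, mul_zero, add_zero] at H1
  have H2 := emultiplicity_differentIdeal_eq_finsum_add_card_mul R F₂ 𝔓 h𝔓
    (hΓ₂.le.trans inf_le_right)
  -- transitivity along `R → S_F → S_{Z'}` and `v_{𝔓_{Z'}}(𝔇_{S_{Z'}/S_F}) = 0`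
  letI algF : Algebra (integralClosure R F) (integralClosure R F₂) :=
    (((IntermediateField.inclusion hle).restrictScalars R).mapIntegralClosure).toRingHom.toAlgebra
  letI smulF : SMul (integralClosure R F) (integralClosure R F₂) := algF.toSMul
  letI modF : Module (integralClosure R F) (integralClosure R F₂) := algF.toModule
  haveI : IsScalarTower R (integralClosure R F) (integralClosure R F₂) :=
    IsScalarTower.of_algebraMap_eq fun _ => Subtype.ext rfl
  haveI : IsScalarTower (integralClosure R F) (integralClosure R F₂) (integralClosure R L) :=
    IsScalarTower.of_algebraMap_eq fun _ => Subtype.ext rfl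
  haveI : FaithfulSMul (integralClosure R F) (integralClosure R F₂) := by
    refine (faithfulSMul_iff_algebraMap_injective _ _).mpr fun a b h => ?_
    have h' := congrArg (fun z : integralClosure R F₂ => ((z : F₂) : L)) h
    exact Subtype.ext (Subtype.ext h')
  haveI : Module.IsTorsionFree (integralClosure R F) (integralClosure R F₂) := by
    rw [Module.isTorsionFree_iff_faithfulSMul]; infer_instance
  haveI : Module.Finite R (integralClosure R F₂) :=
    IsIntegralClosure.finite R K F₂ (integralClosure R F₂)
  haveI : Module.Finite R (integralClosure R F) :=
    IsIntegralClosure.finite R K F (integralClosure R F)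
  haveI : Module.Finite (integralClosure R F) (integralClosure R F₂) :=
    Module.Finite.of_restrictScalars_finite R _ _
  set 𝔓₂ : Ideal (integralClosure R F₂) := 𝔓.under (integralClosure R F₂) with h𝔓₂
  have h𝔓₂ne : 𝔓₂ ≠ ⊥ := Ideal.IsIntegral.comap_ne_bot _ h𝔓
  have hunder : 𝔓₂.under (integralClosure R F) = 𝔓.under (integralClosure R F) :=
    Ideal.under_under 𝔓
  have hFne : 𝔓.under (integralClosure R F) ≠ ⊥ := Ideal.IsIntegral.comap_ne_bot _ h𝔓
  have HT := emultiplicity_differentIdeal_eq_add (A := R) (B := integralClosure R F)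
    (C := integralClosure R F₂) 𝔓₂ h𝔓₂ne
  have he₂ : 𝔓₂.ramificationIdx (integralClosure R F) = 1 := by
    have ht := Ideal.ramificationIdx_tower (R := integralClosure R F) 𝔓₂ 𝔓
    rw [heF F, heF F₂, hΓ₂, hHDI] at ht
    exact (Nat.eq_of_mul_eq_mul_right Nat.card_pos ((one_mul _).trans ht)).symm
  have hm₂ : emultiplicity 𝔓₂ (differentIdeal (integralClosure R F) (integralClosure R F₂)) = 0 := by
    haveI : Finite (integralClosure R F ⧸ 𝔓.under (integralClosure R F)) :=
      Finite.of_injective _ Ideal.algebraMap_quotient_injective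
    haveI : Finite (integralClosure R F ⧸ 𝔓₂.under (integralClosure R F)) := by
      rw [hunder]; infer_instance
    exact emultiplicity_differentIdeal_eq_zero_of_ramificationIdx_eq_one _ he₂
  have he₂' : (𝔓₂.under (integralClosure R F)).ramificationIdx' 𝔓₂ = 1 := by
    rw [Ideal.ramificationIdx'_eq_ramificationIdx _ 𝔓₂ (hunder ▸ hFne), he₂]
  rw [hm₂, zero_add, he₂', Nat.cast_one, one_mul, hunder] at HT
  -- `HT : v_{𝔓_{Z'}}(𝔇_{S_{Z'}/R}) = v_{𝔓_F}(𝔇_{S_F/R})`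
  have hcomap₂ : 𝔓.comap (F₂.integralClosureInclusion R) = 𝔓₂ := Ideal.ext fun _ => Iff.rfl
  rw [hcomap₂, HT] at H2
  -- the inertia cardinalities
  have hc₂ : Nat.card (𝔓.inertia F₂.fixingSubgroup) = Nat.card ↥(F.fixingSubgroup ⊓ I) := by
    rw [card_inertia_subgroup_eq R, hΓ₂, hHDI]
  have hc : Nat.card (𝔓.inertia F.fixingSubgroup) = Nat.card ↥(F.fixingSubgroup ⊓ I) := by
    rw [card_inertia_subgroup_eq R]
  rw [hc₂] at H2
  rw [hc]
  -- pass to finite sums and subtract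
  rw [H1] at H2
  rw [finsum_cond_eq_sum_of_cond_iff (t := Finset.univ.filter fun s => s ∈ D ∧ s ≠ 1) _
      (by intro s _; simp only [Finset.mem_filter, Finset.mem_univ, true_and, hΓ₁]),
    finsum_cond_eq_sum_of_cond_iff (t := Finset.univ.filter fun s => s ∈ F.fixingSubgroup ⊓ D ∧ s ≠ 1) _
      (by intro s _; simp only [Finset.mem_filter, Finset.mem_univ, true_and, hΓ₂]),
    ← Finset.sum_filter_add_sum_filter_not (Finset.univ.filter fun s => s ∈ D ∧ s ≠ 1) (· ∈ F.fixingSubgroup),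
    Finset.filter_filter, Finset.filter_filter] at H2
  have hX : (Finset.univ.filter fun s : L ≃ₐ[K] L => (s ∈ D ∧ s ≠ 1) ∧ s ∈ F.fixingSubgroup) =
      Finset.univ.filter fun s => s ∈ F.fixingSubgroup ⊓ D ∧ s ≠ 1 :=
    Finset.filter_congr fun s _ => by rw [Subgroup.mem_inf]; tauto
  have hY : (Finset.univ.filter fun s : L ≃ₐ[K] L => (s ∈ D ∧ s ≠ 1) ∧ s ∉ F.fixingSubgroup) =
      Finset.univ.filter fun s => s ∈ D ∧ s ∉ F.fixingSubgroup :=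
    Finset.filter_congr fun s _ =>
      ⟨fun h => ⟨h.1.1, h.2⟩, fun h => ⟨⟨h.1, fun (h1 : s = 1) => h.2 (h1 ▸ F.fixingSubgroup.one_mem)⟩, h.2⟩⟩
  rw [hX, hY] at H2
  have hXfin : ∑ s ∈ Finset.univ.filter (fun s : L ≃ₐ[K] L => s ∈ F.fixingSubgroup ⊓ D ∧ s ≠ 1),
      lowerIndex 𝔓 (L ≃ₐ[K] L) s ≠ ⊤ :=
    WithTop.sum_ne_top.2 fun s hs => hfin s (Finset.mem_filter.mp hs).2.2
  have hYeq : ∑ s ∈ Finset.univ.filter (fun s : L ≃ₐ[K] L => s ∈ D ∧ s ∉ F.fixingSubgroup),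
      lowerIndex 𝔓 (L ≃ₐ[K] L) s =
      (Nat.card ↥(F.fixingSubgroup ⊓ I) : ℕ∞) * emultiplicity (𝔓.under (integralClosure R F))
        (differentIdeal R (integralClosure R F)) :=
    WithTop.add_left_cancel hXfin H2
  -- only `s ∈ D ∖ F.fixingSubgroup` contribute to `Σ_{s ∉ F.fixingSubgroup} i_G(s)`
  show (Nat.card ↥(F.fixingSubgroup ⊓ I) : ℕ∞) * emultiplicity (𝔓.under (integralClosure R F))
      (differentIdeal R (integralClosure R F)) =
    ∑ s ∈ Finset.univ.filter (fun s : L ≃ₐ[K] L => s ∉ F.fixingSubgroup), lowerIndex 𝔓 (L ≃ₐ[K] L) s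
  rw [← Finset.sum_filter_add_sum_filter_not (Finset.univ.filter fun s : L ≃ₐ[K] L => s ∉ F.fixingSubgroup)
      (· ∈ D), Finset.filter_filter, Finset.filter_filter]
  have hzero : ∑ s ∈ Finset.univ.filter (fun s : L ≃ₐ[K] L => s ∉ F.fixingSubgroup ∧ s ∉ D),
      lowerIndex 𝔓 (L ≃ₐ[K] L) s = 0 :=
    Finset.sum_eq_zero fun s hs => lowerIndex_eq_zero_of_smul_ne (Finset.mem_filter.mp hs).2.2
  have hfilt : (Finset.univ.filter fun s : L ≃ₐ[K] L => s ∉ F.fixingSubgroup ∧ s ∈ D) =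
      Finset.univ.filter fun s => s ∈ D ∧ s ∉ F.fixingSubgroup :=
    Finset.filter_congr fun s _ => and_comm
  rw [hzero, add_zero, hfilt, hYeq]


end Different

/-! ### Frobenius reciprocity for the coset form of an induced function -/

section Frobenius

variable {G : Type*} [Group G] [Fintype G] (H : Subgroup G) [Fintype (G ⧸ H)] [Fintype H]

omit [Fintype (G ⧸ H)] in
/-- Summing an extension by zero from `H` against a function on `G` is summing over `H`. [folklore] -/
theorem sum_extend_val_mul [DecidablePred (· ∈ H)] (θ : H → ℂ) (φ : G → ℂ) :
    ∑ u : G, Function.extend (Subtype.val : H → G) θ 0 u * φ u = ∑ h : H, θ h * φ h := by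
  rw [← Finset.sum_filter_add_sum_filter_not Finset.univ (· ∈ H)]
  have h0 : ∑ u ∈ Finset.univ.filter (fun u : G => u ∉ H),
      Function.extend (Subtype.val : H → G) θ 0 u * φ u = 0 := by
    refine Finset.sum_eq_zero fun u hu => ?_
    rw [Finset.mem_filter] at hu
    rw [Function.extend_apply' _ _ _ (fun ⟨a, ha⟩ => hu.2 (ha ▸ a.2)), Pi.zero_apply, zero_mul]
  rw [h0, add_zero, Finset.sum_subtype (Finset.univ.filter (· ∈ H)) (p := (· ∈ H)) (fun u => by simp)]
  refine Finset.sum_congr rfl fun h _ => ?_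
  rw [Subtype.val_injective.extend_apply]

/-- **Frobenius reciprocity in coset form** (Serre, *Linear Representations of Finite Groups*,
§7.2, Thm. 13 with the coset formula for `Ind`: "`Ind f(s) = Σ_{r ∈ R} f(r⁻¹ s r)`"; Neukirch
VII (10.2)).  If `χ(s) = Σ_{q ∈ G/H} θ̇(q̇⁻¹ s q̇)` (`θ̇` the extension of `θ : H → ℂ` by zero,
`q̇ = q.out`) and `φ` is a class function on `G`, then
`Σ_{s ∈ G} χ(s) φ(s) = (G : H) · Σ_{h ∈ H} θ(h) φ(h)` (substitute `s = q̇ u q̇⁻¹` in each coset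
sum). [cite: SerreLinearRepresentations1977, §7.2 Thm. 13] -/
theorem sum_mul_eq_index_mul_sum_of_eq_sum_quotient [DecidablePred (· ∈ H)] (θ : H → ℂ)
    (χ φ : G → ℂ)
    (hχ : ∀ s, χ s = ∑ q : G ⧸ H, Function.extend (Subtype.val : H → G) θ 0 (q.out⁻¹ * s * q.out))
    (hφ : ∀ s t : G, φ (t * s * t⁻¹) = φ s) :
    ∑ s : G, χ s * φ s = (H.index : ℂ) * ∑ h : H, θ h * φ h := by
  simp_rw [hχ, Finset.sum_mul]
  rw [Finset.sum_comm]
  have inner : ∀ q : G ⧸ H,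
      ∑ s : G, Function.extend (Subtype.val : H → G) θ 0 (q.out⁻¹ * s * q.out) * φ s =
        ∑ h : H, θ h * φ h := by
    intro q
    rw [← sum_extend_val_mul H θ φ]
    have hb : Function.Bijective (fun s : G => q.out⁻¹ * s * q.out) := by
      convert (MulAut.conj q.out⁻¹).bijective using 1
      ext s
      simp
    refine Fintype.sum_bijective (fun s => q.out⁻¹ * s * q.out) hb _ _ fun s => ?_
    have : φ s = φ (q.out⁻¹ * s * q.out) := by
      conv_lhs => rw [← hφ s q.out⁻¹]
      rw [inv_inv]
    rw [this]
  rw [Finset.sum_congr rfl fun q _ => inner q, Finset.sum_const, Finset.card_univ, nsmul_eq_mul,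
    Subgroup.index_eq_card, Nat.card_eq_fintype_card]

end Frobenius

/-! ### The local induction formula -/

section MainLocal

variable (R : Type*) {K L : Type*} [CommRing R] [IsDedekindDomain R] [Field K] [Field L]
  [Algebra R K] [IsFractionRing R K] [Algebra R L] [Algebra K L] [IsScalarTower R K L]
  [FiniteDimensional K L] [IsGalois K L]

attribute [local instance] Ideal.Quotient.field FractionRing.liftAlgebra
  FractionRing.isScalarTower_liftAlgebra

attribute [local instance] integralClosureAlgebra integralClosure_isScalarTower_left
  integralClosure_isScalarTower_bot integralClosure_faithfulSMul integralClosure_isIntegral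
  integralClosure_isTorsionFree isMaximal_under_integralClosure under_integralClosure_liesOver
  residueAlgebra residueSMul isScalarTower_residue

attribute [local instance] integralClosure_moduleFinite

/-- **`Σ_{𝔓 ∣ 𝔮} f(𝔓|𝔮) Σ_{t ∉ H} i_𝔓(t) = #H · v_𝔮(𝔇_{S_F/R})`**: summing Serre's
`e(𝔓|𝔮) v_𝔮(𝔇_{S_F/R}) = Σ_{t ∉ H} i_𝔓(t)`
(`card_inertia_mul_emultiplicity_differentIdeal_under_eq_sum_lowerIndex`) over the primes `𝔓` of
`S` above a nonzero prime `𝔮` of `S_F`, weighted by the residue degrees, and using the fundamental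
identity `Σ_{𝔓 ∣ 𝔮} e(𝔓|𝔮) f(𝔓|𝔮) = [L : F] = #H` (Mathlib `Ideal.sum_ramification_inertia`).
This is the term `ν_{𝔓'_τ} χ(1)` of Neukirch VII (11.7) (iii), proof, summed over `τ`.
[cite: SerreLocalFields1979, Ch. IV §1, Cor. to Prop. 4] [cite: NeukirchANT1999, VII (11.7) (iii) proof] -/
theorem sum_inertiaDeg_mul_sum_lowerIndex_not_mem
    [IsDedekindDomain (integralClosure R L)] [Module.IsTorsionFree R (integralClosure R L)]
    (F : IntermediateField K L) [IsDedekindDomain (integralClosure R F)]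
    [Module.IsTorsionFree R (integralClosure R F)] [CharZero R] [CharZero L]
    [Fintype (L ≃ₐ[K] L)] [DecidablePred (· ∈ F.fixingSubgroup)]
    {𝔮 : Ideal (integralClosure R F)} [𝔮.IsMaximal] (h𝔮 : 𝔮 ≠ ⊥)
    (hfin : ∀ 𝔓 ∈ IsDedekindDomain.primesOverFinset 𝔮 (integralClosure R L),
      Finite (integralClosure R L ⧸ 𝔓)) :
    ∑ 𝔓 ∈ IsDedekindDomain.primesOverFinset 𝔮 (integralClosure R L),
        (𝔓.inertiaDeg (integralClosure R F) : ℂ) *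
          ∑ t ∈ Finset.univ.filter (· ∉ F.fixingSubgroup),
            ((lowerIndex 𝔓 (L ≃ₐ[K] L) t).toNat : ℂ) =
      (Nat.card F.fixingSubgroup : ℂ) *
        ((emultiplicity 𝔮 (differentIdeal R (integralClosure R F))).toNat : ℂ) := by
  classical
  haveI : IsFractionRing (integralClosure R L) L :=
    integralClosure.isFractionRing_of_finite_extension K L
  haveI : IsFractionRing (integralClosure R F) F :=
    integralClosure.isFractionRing_of_finite_extension K F
  haveI : FaithfulSMul (L ≃ₐ[K] L) (integralClosure R L) := faithfulSMul_algEquiv_integralClosure R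
  set d := (emultiplicity 𝔮 (differentIdeal R (integralClosure R F))).toNat with hd
  -- each prime `𝔓 ∣ 𝔮` contributes `f(𝔓|𝔮) e(𝔓|𝔮) d`
  have hterm : ∀ 𝔓 ∈ IsDedekindDomain.primesOverFinset 𝔮 (integralClosure R L),
      (𝔓.inertiaDeg (integralClosure R F) : ℂ) *
          ∑ t ∈ Finset.univ.filter (· ∉ F.fixingSubgroup),
            ((lowerIndex 𝔓 (L ≃ₐ[K] L) t).toNat : ℂ) =
        (d : ℂ) * ((𝔮.ramificationIdx' 𝔓 * 𝔮.inertiaDeg' 𝔓 : ℕ) : ℂ) := by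
    intro 𝔓 h𝔓
    obtain ⟨h𝔓ne, h𝔓max⟩ := ne_bot_and_isMaximal_of_mem_primesOverFinset
      (T := integralClosure R F) h𝔓
    haveI := h𝔓max
    have hunder : 𝔓.under (integralClosure R F) = 𝔮 := ((mem_primesOverFinset_iff' h𝔮).mp h𝔓).2
    haveI : 𝔓.LiesOver 𝔮 := ⟨hunder.symm⟩
    haveI := hfin 𝔓 h𝔓
    haveI : (𝔓.under R).IsMaximal := Ideal.IsMaximal.under R 𝔓
    haveI : Algebra.IsSeparable (R ⧸ 𝔓.under R) (integralClosure R L ⧸ 𝔓) :=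
      isSeparable_residue_of_finite 𝔓
    -- Serre's identity at `𝔓`, in `ℕ∞`
    have hA7 := card_inertia_mul_emultiplicity_differentIdeal_under_eq_sum_lowerIndex R F 𝔓 h𝔓ne
    rw [hunder] at hA7
    -- all terms are finite
    obtain ⟨Nb, hNb⟩ := Ideal.ramificationSubgroup_eventually_eq_bot_holds 𝔓 (L ≃ₐ[K] L)
      (Ideal.IsMaximal.ne_top inferInstance)
    have htfin : ∀ t ∈ Finset.univ.filter (fun t : L ≃ₐ[K] L => t ∉ F.fixingSubgroup),
        lowerIndex 𝔓 (L ≃ₐ[K] L) t ≠ ⊤ := fun t ht =>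
      lowerIndex_ne_top 𝔓 (hNb Nb le_rfl) fun (h1 : t = 1) =>
        (Finset.mem_filter.mp ht).2 (h1 ▸ F.fixingSubgroup.one_mem)
    have hsumfin : ∑ t ∈ Finset.univ.filter (fun t : L ≃ₐ[K] L => t ∉ F.fixingSubgroup),
        lowerIndex 𝔓 (L ≃ₐ[K] L) t ≠ ⊤ := WithTop.sum_ne_top.2 htfin
    have hcard0 : (Nat.card (𝔓.inertia F.fixingSubgroup) : ℕ∞) ≠ 0 := by
      exact_mod_cast Nat.card_pos.ne'
    have hmfin : emultiplicity 𝔮 (differentIdeal R (integralClosure R F)) ≠ ⊤ := fun htop =>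
      hsumfin (by rw [← hA7, htop, ENat.mul_top hcard0])
    have hcast : ((Nat.card (𝔓.inertia F.fixingSubgroup) * d : ℕ) : ℕ∞) =
        ((∑ t ∈ Finset.univ.filter (fun t : L ≃ₐ[K] L => t ∉ F.fixingSubgroup),
          (lowerIndex 𝔓 (L ≃ₐ[K] L) t).toNat : ℕ) : ℕ∞) := by
      rw [Nat.cast_mul, hd, ENat.coe_toNat hmfin, hA7, Nat.cast_sum]
      exact Finset.sum_congr rfl fun t ht => (ENat.coe_toNat (htfin t ht)).symm
    have hnat : Nat.card (𝔓.inertia F.fixingSubgroup) * d =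
        ∑ t ∈ Finset.univ.filter (fun t : L ≃ₐ[K] L => t ∉ F.fixingSubgroup),
          (lowerIndex 𝔓 (L ≃ₐ[K] L) t).toNat := by exact_mod_cast hcast
    have hℂ : ∑ t ∈ Finset.univ.filter (· ∉ F.fixingSubgroup),
        ((lowerIndex 𝔓 (L ≃ₐ[K] L) t).toNat : ℂ) =
          ((Nat.card (𝔓.inertia F.fixingSubgroup) * d : ℕ) : ℂ) := by
      rw [hnat, Nat.cast_sum]
    rw [hℂ, ← hunder, ramificationIdx'_under_eq_card_inertia R F 𝔓 h𝔓ne, hunder,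
      Ideal.inertiaDeg'_eq_inertiaDeg 𝔮 𝔓]
    push_cast
    ring
  rw [Finset.sum_congr rfl hterm, ← Finset.mul_sum, ← Nat.cast_sum,
    Ideal.sum_ramification_inertia (S := integralClosure R L) (K := F) (L := L) h𝔮,
    ← IsGalois.card_fixingSubgroup_eq_finrank F, mul_comm]

/-- **Neukirch VII (11.7) (iii) / Serre VI §2 Prop. 4 at a prime, for class functions (the local
induction formula).**  Let `R` be Dedekind of characteristic `0` with fraction field `K`, `L/K`
finite Galois with group `G`, `S = integralClosure R L` with finite residue fields, `F` an
intermediate field with `H = Gal(L/F)`, `S_F = integralClosure R F`, `𝔭 ≠ 0` a maximal ideal of `R`,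
`𝔓₀ ∣ 𝔭` a prime of `S`.  Let `θ` be a class function on `H` and `χ` the class function on `G`
induced by it in coset form, `χ(s) = Σ_{q ∈ G/H} θ̇(q̇⁻¹ s q̇)`.  For every choice of primes
`P(𝔮) ∣ 𝔮` of `S` above the primes `𝔮 ∣ 𝔭` of `S_F`:
`(1/#I_{𝔓₀}) Σ_s i_{𝔓₀}(s)(χ(1) - χ(s)) = Σ_{𝔮 ∣ 𝔭} f(𝔮|𝔭) · ( θ(1) v_𝔮(𝔇_{S_F/R}) + (1/#I^H_{P(𝔮)}) Σ_{t ∈ H} i_{P(𝔮)}(t)(θ(1) - θ(t)) )`,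
i.e. `f_𝔭(χ) = Σ_{𝔮 ∣ 𝔭} f(𝔮|𝔭) (θ(1) d_𝔮 + f_𝔮(θ))` with Serre's `f = Σᵢ (gᵢ/g₀)(φ(1) - φ(Gᵢ))`
in numerator form — Neukirch's `f(χ_*|G_𝔓) = Σ_τ (ν_{𝔓'_τ} χ(1) + f_{𝔓'_τ} f(χ|H_{𝔓^τ}))`.
Proof: pair `χ` with the class function `A_𝔭 = Σ_{𝔓 ∣ 𝔭} f(𝔓|𝔭) a_𝔓`
(`card_inertia_mul_sum_artinClassFun_mul`), use Frobenius reciprocity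
(`sum_mul_eq_index_mul_sum_of_eq_sum_quotient`), restrict `A_𝔭` to `H`
(`artinClassFun_eq_sum_sub`), evaluate the `H`-pairings at the primes `P(𝔮)`, and insert
`Σ_{𝔓 ∣ 𝔮} f(𝔓|𝔮) Σ_{t ∉ H} i_𝔓(t) = #H v_𝔮(𝔇_{S_F/R})` (`sum_inertiaDeg_mul_sum_lowerIndex_not_mem`).
[cite: NeukirchANT1999, VII (11.7) (iii) and its proof (pp. 533–534)]
[cite: SerreLocalFields1979, Ch. VI §2 Prop. 4 with Corollary; Ch. IV §1 Cor. to Prop. 4] -/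
theorem card_inertia_inv_mul_sum_lowerIndex_eq_sum_of_induced
    [IsDedekindDomain (integralClosure R L)] [Module.IsTorsionFree R (integralClosure R L)]
    (F : IntermediateField K L) [IsDedekindDomain (integralClosure R F)]
    [Module.IsTorsionFree R (integralClosure R F)] [CharZero R] [CharZero L]
    [Fintype (L ≃ₐ[K] L)] [DecidableEq (L ≃ₐ[K] L)] [DecidablePred (· ∈ F.fixingSubgroup)]
    [Fintype ((L ≃ₐ[K] L) ⧸ F.fixingSubgroup)]
    {𝔭 : Ideal R} [𝔭.IsMaximal] (h𝔭 : 𝔭 ≠ ⊥)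
    (𝔓₀ : Ideal (integralClosure R L)) [𝔓₀.IsMaximal] [𝔓₀.LiesOver 𝔭]
    (hfin : ∀ 𝔓 : Ideal (integralClosure R L), 𝔓.IsMaximal → Finite (integralClosure R L ⧸ 𝔓))
    (θ : F.fixingSubgroup → ℂ) (hθ : ∀ s t : F.fixingSubgroup, θ (t * s * t⁻¹) = θ s)
    (χ : (L ≃ₐ[K] L) → ℂ) (hχc : ∀ s t : L ≃ₐ[K] L, χ (t * s * t⁻¹) = χ s)
    (hχ : ∀ s, χ s = ∑ q : (L ≃ₐ[K] L) ⧸ F.fixingSubgroup,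
      Function.extend (Subtype.val : F.fixingSubgroup → L ≃ₐ[K] L) θ 0 (q.out⁻¹ * s * q.out))
    (P : Ideal (integralClosure R F) → Ideal (integralClosure R L))
    (hP : ∀ 𝔮 ∈ IsDedekindDomain.primesOverFinset 𝔭 (integralClosure R F),
      (P 𝔮).IsMaximal ∧ (P 𝔮).under (integralClosure R F) = 𝔮) :
    (Nat.card (𝔓₀.inertia (L ≃ₐ[K] L)) : ℂ)⁻¹ *
        ∑ s : L ≃ₐ[K] L, ((lowerIndex 𝔓₀ (L ≃ₐ[K] L) s).toNat : ℂ) * (χ 1 - χ s) =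
      ∑ 𝔮 ∈ IsDedekindDomain.primesOverFinset 𝔭 (integralClosure R F), (𝔮.inertiaDeg R : ℂ) *
        (θ 1 * ((emultiplicity 𝔮 (differentIdeal R (integralClosure R F))).toNat : ℂ) +
          (Nat.card ((P 𝔮).inertia F.fixingSubgroup) : ℂ)⁻¹ *
            ∑ t : F.fixingSubgroup, ((lowerIndex (P 𝔮) F.fixingSubgroup t).toNat : ℂ) *
              (θ 1 - θ t)) := by
  obtain rfl : 𝔭 = 𝔓₀.under R := Ideal.LiesOver.over
  -- instances
  haveI : IsFractionRing (integralClosure R L) L :=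
    integralClosure.isFractionRing_of_finite_extension K L
  haveI : IsFractionRing (integralClosure R F) F :=
    integralClosure.isFractionRing_of_finite_extension K F
  haveI : FaithfulSMul (L ≃ₐ[K] L) (integralClosure R L) := faithfulSMul_algEquiv_integralClosure R
  haveI : Module.Finite R (integralClosure R L) :=
    IsIntegralClosure.finite R K L (integralClosure R L)
  haveI : FaithfulSMul R (integralClosure R L) := faithfulSMul_integralClosure R (K := K) (L := L)
  haveI : IsGaloisGroup (L ≃ₐ[K] L) R (integralClosure R L) :=
    IsGaloisGroup.of_isFractionRing _ _ _ K L
  haveI hGalF := isGaloisGroup_fixingSubgroup_integralClosure R F (K := K) (L := L)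
  haveI := hfin 𝔓₀ inferInstance
  haveI : Algebra.IsSeparable (R ⧸ 𝔓₀.under R) (integralClosure R L ⧸ 𝔓₀) :=
    isSeparable_residue_of_finite 𝔓₀
  -- the class function `A = A_𝔭` of `G` (as an opaque local function with its defining equation)
  obtain ⟨A, hA⟩ : ∃ A : (L ≃ₐ[K] L) → ℂ, A = fun s =>
      ∑ 𝔓 ∈ IsDedekindDomain.primesOverFinset (𝔓₀.under R) (integralClosure R L),
        (𝔓.inertiaDeg R : ℂ) * (if s = 1 then ∑ t : L ≃ₐ[K] L, ((lowerIndex 𝔓 (L ≃ₐ[K] L) t).toNat : ℂ)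
          else -((lowerIndex 𝔓 (L ≃ₐ[K] L) s).toNat : ℂ)) := ⟨_, rfl⟩
  have hAclass : ∀ s t : L ≃ₐ[K] L, A (t * s * t⁻¹) = A s := fun s t => by
    simp only [hA]
    exact artinClassFun_conj h𝔭 t s
  -- Step 1: pairing `χ` with `A` at `𝔓₀`
  have h1 : (Nat.card (𝔓₀.inertia (L ≃ₐ[K] L)) : ℂ) * ∑ s : L ≃ₐ[K] L, A s * χ s =
      (Fintype.card (L ≃ₐ[K] L) : ℂ) *
        ∑ s : L ≃ₐ[K] L, ((lowerIndex 𝔓₀ (L ≃ₐ[K] L) s).toNat : ℂ) * (χ 1 - χ s) := by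
    simp only [hA]
    exact card_inertia_mul_sum_artinClassFun_mul (Γ := L ≃ₐ[K] L) (T := R) h𝔭 𝔓₀ χ hχc
  -- Step 2: Frobenius reciprocity
  have h2 : ∑ s : L ≃ₐ[K] L, A s * χ s =
      (F.fixingSubgroup.index : ℂ) * ∑ h : F.fixingSubgroup, θ h * A h := by
    simp_rw [mul_comm (A _) (χ _)]
    exact sum_mul_eq_index_mul_sum_of_eq_sum_quotient F.fixingSubgroup θ χ A hχ hAclass
  -- Step 3: restriction of `A` to `H`
  have hTS : ∀ 𝔓 : Ideal (integralClosure R L), 𝔓.IsPrime →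
      (𝔓.under (integralClosure R F)).under R = 𝔓.under R := fun 𝔓 _ => Ideal.under_under 𝔓
  have hf : ∀ (𝔮 : Ideal (integralClosure R F)) (𝔓 : Ideal (integralClosure R L)), 𝔓.IsPrime →
      𝔓.under (integralClosure R F) = 𝔮 →
      𝔓.inertiaDeg R = 𝔮.inertiaDeg R * 𝔓.inertiaDeg (integralClosure R F) := by
    intro 𝔮 𝔓 _ h𝔮
    haveI : 𝔓.LiesOver 𝔮 := ⟨h𝔮.symm⟩
    exact Ideal.inertiaDeg_tower 𝔮 𝔓
  have h3 : ∀ h : F.fixingSubgroup, A h =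
      ∑ 𝔮 ∈ IsDedekindDomain.primesOverFinset (𝔓₀.under R) (integralClosure R F),
        (𝔮.inertiaDeg R : ℂ) *
        ((∑ 𝔓 ∈ IsDedekindDomain.primesOverFinset 𝔮 (integralClosure R L),
            (𝔓.inertiaDeg (integralClosure R F) : ℂ) *
              (if h = 1 then ∑ t : F.fixingSubgroup, ((lowerIndex 𝔓 F.fixingSubgroup t).toNat : ℂ)
                else -((lowerIndex 𝔓 F.fixingSubgroup h).toNat : ℂ))) +
          (if (h : L ≃ₐ[K] L) = 1 then
              ∑ 𝔓 ∈ IsDedekindDomain.primesOverFinset 𝔮 (integralClosure R L),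
                (𝔓.inertiaDeg (integralClosure R F) : ℂ) *
                  ∑ t ∈ Finset.univ.filter (· ∉ F.fixingSubgroup),
                    ((lowerIndex 𝔓 (L ≃ₐ[K] L) t).toNat : ℂ)
            else 0)) := by
    intro h
    have := artinClassFun_eq_sum_sub (T := R) (B := integralClosure R F) (S := integralClosure R L)
      F.fixingSubgroup h𝔭 hTS hf h.2
    simp only [hA]
    simpa only [Subtype.coe_eta] using this
  -- Step 4: the `H`-pairings at the chosen primes `P 𝔮`, and Step 5: the different
  have h45 : ∀ 𝔮 ∈ IsDedekindDomain.primesOverFinset (𝔓₀.under R) (integralClosure R F),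
      ∑ h : F.fixingSubgroup, θ h *
        ((∑ 𝔓 ∈ IsDedekindDomain.primesOverFinset 𝔮 (integralClosure R L),
            (𝔓.inertiaDeg (integralClosure R F) : ℂ) *
              (if h = 1 then ∑ t : F.fixingSubgroup, ((lowerIndex 𝔓 F.fixingSubgroup t).toNat : ℂ)
                else -((lowerIndex 𝔓 F.fixingSubgroup h).toNat : ℂ))) +
          (if (h : L ≃ₐ[K] L) = 1 then
              ∑ 𝔓 ∈ IsDedekindDomain.primesOverFinset 𝔮 (integralClosure R L),
                (𝔓.inertiaDeg (integralClosure R F) : ℂ) *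
                  ∑ t ∈ Finset.univ.filter (· ∉ F.fixingSubgroup),
                    ((lowerIndex 𝔓 (L ≃ₐ[K] L) t).toNat : ℂ)
            else 0)) =
      (Nat.card F.fixingSubgroup : ℂ) *
        (θ 1 * ((emultiplicity 𝔮 (differentIdeal R (integralClosure R F))).toNat : ℂ) +
          (Nat.card ((P 𝔮).inertia F.fixingSubgroup) : ℂ)⁻¹ *
            ∑ t : F.fixingSubgroup, ((lowerIndex (P 𝔮) F.fixingSubgroup t).toNat : ℂ) *
              (θ 1 - θ t)) := by
    intro 𝔮 h𝔮
    obtain ⟨hqne, hqmax⟩ := ne_bot_and_isMaximal_of_mem_primesOverFinset (T := R) h𝔮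
    haveI := hqmax
    obtain ⟨hPmax, hPund⟩ := hP 𝔮 h𝔮
    haveI := hPmax
    haveI : (P 𝔮).LiesOver 𝔮 := ⟨hPund.symm⟩
    haveI := hfin (P 𝔮) hPmax
    haveI : Finite (integralClosure R F ⧸ 𝔮) := Finite.of_injective _
      (algebraMap (integralClosure R F ⧸ 𝔮) (integralClosure R L ⧸ P 𝔮)).injective
    haveI : Algebra.IsAlgebraic (integralClosure R F ⧸ 𝔮) (integralClosure R L ⧸ P 𝔮) :=
      Algebra.IsAlgebraic.of_finite _ _
    haveI : Algebra.IsSeparable (integralClosure R F ⧸ 𝔮) (integralClosure R L ⧸ P 𝔮) :=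
      inferInstance
    -- Step 4 at `𝔮`
    have h4 := card_inertia_mul_sum_artinClassFun_mul (Γ := F.fixingSubgroup)
      (T := integralClosure R F) hqne (P 𝔮) θ hθ
    -- Step 5 at `𝔮`
    have h5 := sum_inertiaDeg_mul_sum_lowerIndex_not_mem R F hqne
      (fun 𝔓 h𝔓 => hfin 𝔓 (ne_bot_and_isMaximal_of_mem_primesOverFinset
        (T := integralClosure R F) h𝔓).2)
    -- assemble
    simp_rw [mul_add, Finset.sum_add_distrib]
    have hone : ∑ h : F.fixingSubgroup, θ h *
        (if (h : L ≃ₐ[K] L) = 1 then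
          ∑ 𝔓 ∈ IsDedekindDomain.primesOverFinset 𝔮 (integralClosure R L),
            (𝔓.inertiaDeg (integralClosure R F) : ℂ) *
              ∑ t ∈ Finset.univ.filter (· ∉ F.fixingSubgroup),
                ((lowerIndex 𝔓 (L ≃ₐ[K] L) t).toNat : ℂ) else 0) =
        θ 1 * ((Nat.card F.fixingSubgroup : ℂ) *
          ((emultiplicity 𝔮 (differentIdeal R (integralClosure R F))).toNat : ℂ)) := by
      rw [← h5, Finset.sum_eq_single (1 : F.fixingSubgroup)]
      · simp
      · intro h _ h1
        have h1' : (h : L ≃ₐ[K] L) ≠ 1 := fun e => h1 (Subtype.ext e)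
        rw [if_neg h1', mul_zero]
      · intro h1; exact absurd (Finset.mem_univ _) h1
    have hIH : (Nat.card ((P 𝔮).inertia F.fixingSubgroup) : ℂ) ≠ 0 := by
      exact_mod_cast Nat.card_pos.ne'
    have hpair : ∑ h : F.fixingSubgroup, θ h *
        (∑ 𝔓 ∈ IsDedekindDomain.primesOverFinset 𝔮 (integralClosure R L),
            (𝔓.inertiaDeg (integralClosure R F) : ℂ) *
              (if h = 1 then ∑ t : F.fixingSubgroup, ((lowerIndex 𝔓 F.fixingSubgroup t).toNat : ℂ)
                else -((lowerIndex 𝔓 F.fixingSubgroup h).toNat : ℂ))) =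
        (Nat.card F.fixingSubgroup : ℂ) *
          ((Nat.card ((P 𝔮).inertia F.fixingSubgroup) : ℂ)⁻¹ *
            ∑ t : F.fixingSubgroup, ((lowerIndex (P 𝔮) F.fixingSubgroup t).toNat : ℂ) *
              (θ 1 - θ t)) := by
      simp_rw [mul_comm (θ _) _]
      rw [← Nat.card_eq_fintype_card] at h4
      rw [← mul_assoc, mul_comm (Nat.card F.fixingSubgroup : ℂ), mul_assoc, ← h4,
        ← mul_assoc, inv_mul_cancel₀ hIH, one_mul]
    rw [hpair, hone]
    ring
  -- Step 6: assemble
  have hG : (Fintype.card (L ≃ₐ[K] L) : ℂ) ≠ 0 := Nat.cast_ne_zero.mpr Fintype.card_ne_zero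
  have hI : (Nat.card (𝔓₀.inertia (L ≃ₐ[K] L)) : ℂ) ≠ 0 := by exact_mod_cast Nat.card_pos.ne'
  have hidx : (F.fixingSubgroup.index : ℂ) * (Nat.card F.fixingSubgroup : ℂ) =
      (Fintype.card (L ≃ₐ[K] L) : ℂ) := by
    rw [← Nat.card_eq_fintype_card]; exact_mod_cast F.fixingSubgroup.index_mul_card
  have key : ∑ s : L ≃ₐ[K] L, A s * χ s = (Fintype.card (L ≃ₐ[K] L) : ℂ) *
      ∑ 𝔮 ∈ IsDedekindDomain.primesOverFinset (𝔓₀.under R) (integralClosure R F),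
        (𝔮.inertiaDeg R : ℂ) *
        (θ 1 * ((emultiplicity 𝔮 (differentIdeal R (integralClosure R F))).toNat : ℂ) +
          (Nat.card ((P 𝔮).inertia F.fixingSubgroup) : ℂ)⁻¹ *
            ∑ t : F.fixingSubgroup, ((lowerIndex (P 𝔮) F.fixingSubgroup t).toNat : ℂ) *
              (θ 1 - θ t)) := by
    rw [h2, ← hidx, mul_assoc]
    congr 1
    rw [Finset.mul_sum]
    simp_rw [h3]
    conv_lhs => enter [2, h]; rw [Finset.mul_sum]
    rw [Finset.sum_comm]
    refine Finset.sum_congr rfl fun 𝔮 h𝔮 => ?_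
    conv_lhs => enter [2, h]; rw [mul_left_comm]
    rw [← Finset.mul_sum, h45 𝔮 h𝔮]
    ring
  rw [key] at h1
  -- `h1 : #I₀ · (#G · RHS) = #G · Σ i(χ(1) - χ)`
  have h1' := mul_left_cancel₀ hG ((mul_left_comm _ _ _).symm.trans h1 |>.trans (by rfl))
  rw [← h1', ← mul_assoc, inv_mul_cancel₀ hI, one_mul]

end MainLocal

end Literature.NumberTheory.GaloisRepresentations

end
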